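import Mathlib
import HarnessLib
import Literature.NumberTheory.LFunctions.BourgainTheorem4SixthMoment
import Literature.NumberTheory.LFunctions.BourgainTheorem4Optimisation
import Literature.NumberTheory.LFunctions.ZetaSubconvexityRobertSargos

/-!
# Bourgain's Theorem 4 assembled: from the Huxley–Watt reduction (3.4), the second spacing
# bounds (3.11)/(3.15) and the decoupling Corollary 3 to `|S| ≪ M^{1/2}T^{13/84+ε}` — PROVED

Topic `Literature/NumberTheory/LFunctions`. This file closes the bookkeeping of §4 of J. Bourgain,
*Decoupling, exponential sums and the Riemann zeta function*, J. Amer. Math. Soc. **30** (2017)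
(arXiv:1408.5794, §4 = §3 of the journal numbering), pp. 10–13, around the pieces already proved in
this tree:

* `DoubleLargeSieve.lean` — the Bombieri–Iwaniec double large sieve (3.8), PROVED;
* `BourgainTheorem4.lean` — the first spacing count `A ≤ (π⁴/16) A₆` and (3.10) from Corollary 3,
  and step 6 (Theorem 4 from (3.13), (3.18)), PROVED;
* `BourgainTheorem4SixthMoment.lean` — (3.7) ⇒ (3.8) ⇒ with (3.10) and Huxley's `V`:
  `∑_I |∑_{h ≤ H} αʰe(x(I)·(h,h²,h^{3/2},h^{1/2}))|⁶ ≤ C H^{6+ε}(VB_V)^{1/2}`, PROVED;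
* `BourgainTheorem4Optimisation.lean` — (3.12) ⇒ (3.13), (3.16) ⇒ (3.18), PROVED.

What is added here is the remaining arithmetic of pp. 10–12: the alternative (3.5)/(3.6) with
the trivial bound, the sixth-power Hölder inequality (3.7), and the passage from (3.8)–(3.11) to
(3.12) and from (3.14)–(3.15) to (3.16) (the choice `V = N/Q` or `V = R⁴/N²`), with the
logarithms and `H^{ε}` absorbed into `M^{ε}`. As a result Theorem 4 for `F = log`
(`Literature.NumberTheory.LFunctions.Bourgain2017_theorem4_log`) is PROVED from exactly the three
displayed inputs that the paper imports from the Bombieri–Iwaniec–Huxley–Watt theory, each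
written out as an explicit hypothesis on explicit data, plus the paper's own Corollary 3:

* **(3.4)** (hypothesis `h34`): the Huxley–Watt reduction [H-W] §4 with [H-W] Lemma 2.1 — for
  `T ≥ T₀`, `M ≤ √T`, `1 < N < M`, `R ≤ N ≤ R²` (`R = ⌈(2M³/(cNT))^{1/2}⌉`, (3.3)), there are
  `Q, H ∈ ℕ`, `α ∈ ℂ`, a finite set `𝓘` of minor arcs and vectors `x(I) ∈ ∏[-X_j, X_j]`,
  `X = (1/2, 1/2, (R/Q)²H^{1/2}, (R/Q)²H^{1/2})`, with "`Q ≥ R`", "`H ≥ NQ/R² ≫ H`",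
  "`∑_ℓ |𝓘(Q,ℓ)| ≪ MR²/(NQ²)`", `|α| ≤ 1`, and
  `|S| ≪ M log N/N^{1/2} + (R log²N/Q^{1/2}) ∑_{I ∈ 𝓘} (|∑_{h ≤ H} αʰ e(x(I)·(h,h²,h^{3/2},h^{1/2}))| + Q/R)`;
  the data are parameters `Q H α 𝓘 x` of the theorems (functions of `(T, M, N)`), so that the
  next two hypotheses speak about the same vectors `x(I)`;
* **(3.11)** as printed before it (hypothesis `h311`): Huxley–Watt's second spacing bound
  "`B₁ ≪ Δ₁Δ₂(M/N)²(Q/R)⁴` if `N = MT^{-2/7}`, where `Δ₁ = 1/(X₂Y₂) = 1/(3H²)` and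
  `Δ₂ = 1/(X₃Y₃) = Q²/(6R²H²)`", asked only in the regime (3.6) `Q < R^{2/3}N^{1/3}`;
* **(3.15)** (hypothesis `h315`): Huxley's resonance-curve bound [H1] §7, "if `M ≤ √T`, and if one
  has either `V = N/Q ≪ R⁴/N²`, or else `V = R⁴/N²`, then
  `VB_V ≪ (VMR²/(NQ²) + Δ₁Δ₂Δ₄^{2/3}(M/N)²)(Q/R)⁴`, `Δ₄ = Q²/(6R²H)`", again only in the
  regime (3.6) (with `N/Q ≤ R⁴/N²` as the side condition of the first alternative);
* **Corollary 3** (2.28) (hypothesis `hC3`, as in `BourgainDecouplingMeanValue.lean`).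

## Main results (all PROVED; no named fact is introduced)

* `Literature.NumberTheory.LFunctions.Bourgain2017_eq312_log_of_reduction` — (3.4) + (3.11) +
  Cor. 3 ⇒ **(3.12)** in the form consumed by
  `Literature.NumberTheory.LFunctions.Bourgain2017_eq313_log_of_eq312`.
* `Literature.NumberTheory.LFunctions.Bourgain2017_eq316_log_of_reduction` — (3.4) + (3.15) +
  Cor. 3 ⇒ **(3.16)** in the form consumed by
  `Literature.NumberTheory.LFunctions.Bourgain2017_eq318_log_of_eq316`.
* `Literature.NumberTheory.LFunctions.Bourgain2017_theorem4_log_of_reduction` — **Theorem 4 for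
  `F = log`** from (3.4), (3.11), (3.15) and Corollary 3; and the corollary
  `Bourgain2017_eq51_log_of_reduction_of_sargos` ((5.1) for `F = log`,
  `Literature.NumberTheory.LFunctions.Bourgain2017_eq51_log`, with the Robert–Sargos
  fourth-derivative test `Literature.NumberTheory.LFunctions.Sargos2003_lemma4` below `T^{17/42}`,
  via `Literature.NumberTheory.LFunctions.Bourgain2017_eq51_log_of_theorem4_of_sargos`; Theorem 5
  `Literature.NumberTheory.LFunctions.bourgain_subconvexity` then follows by
  `Literature.NumberTheory.LFunctions.bourgain_subconvexity_of_theorem4_of_sargos`).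
* Namespace `Literature.NumberTheory.LFunctions.BourgainTheorem4`: the bookkeeping in the
  variables `M, N, R, Q, H, #𝓘` as pure real inequalities (`caseA_bound`, `caseB_split`,
  `caseB_w312`, `caseB_w316_*`, `log_absorb`, …), proved by comparing logarithms.

## The argument (pp. 10–12 of the paper) and where the constants go

Fix `ε > 0`; put `ε₁ = min(ε/4, 1)`, `L = log N`. At a point `(T, M, N)` of the range let
`Q, H, α, 𝓘, x` be the data of (3.4), `cI = #𝓘 ≤ C₀MR²/(NQ²)`, `Σ₁ = ∑_I |∑_h …|`,
`Σ₆ = ∑_I |∑_h …|⁶`.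
* If `Q ≥ R^{2/3}N^{1/3}` (not (3.6)): the trivial bound `Σ₁ ≤ cI·H ≤ C₀²M/Q` and (3.4) give
  `|S| ≤ 3C₀³ M(L + L²)/N^{1/2}` (`caseA_bound`), i.e. (3.5), whose sixth power
  `≪ M⁶(L⁶ + L¹²)/N³` is below both targets.
* If `Q < R^{2/3}N^{1/3}` ((3.6), so `Q ≤ N`): `|S| ≤ u + v + w` with `u = C₀ML/√N`,
  `v = C₀(RL²/√Q) cI Q/R ≤ C₀²L²M R²/(NQ^{3/2})`, `w = C₀(RL²/√Q)Σ₁`, and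
  `|S|⁶ ≤ 3⁵(u⁶ + v⁶ + w⁶)`, `u⁶ = C₀⁶M⁶L⁶/N³`, `v⁶ ≤ C₀¹²M⁶L¹²R³/N⁶`,
  `w⁶ ≤ C₀⁶(R⁶L¹²/Q³) cI⁵ Σ₆` (Hölder, `caseB_split`) — this is (3.7). By
  `Bourgain2017_sixthMoment_of_corollary3` ((3.8) + (3.10), with `X₃ = (R/Q)²H^{1/2}`,
  `H^{-1/2} ≤ X₃ ≤ H^{1/2}` because `R ≤ Q ≤ N` and `H ≥ NQ/R²`), `Σ₆ ≤ C_A H^{6+ε₁}(VB_V)^{1/2}`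
  for every `V ≥ 1`.
  - With `V = 1` and (3.11): `w⁶ ≤ C₀¹⁶C_AC₁ L¹²N^{2ε₁} M⁶/(N²R)` (`caseB_w312`: the paper's
    `(M^{5+ε}R⁴N/Q⁷)(MRQ/N³) ≤ (M^{6+ε}/N³)(N/R)`, using `H ≤ C₀NQ/R²` in `H^{6+ε₁}`, `H ≥ NQ/R²`
    in `Δ₁Δ₂`, and `R ≤ Q`); with `u⁶, v⁶ ≪ M⁶L¹²/(N²R)` (`R ≤ N`) and
    `L¹²N^{2ε₁}, L⁶, L¹² ≤ K(ε) M^ε` (`log_absorb`) this is (3.12).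
  - With (3.15): if `N³ ≤ R⁵` take `V = N/Q` (admissible: `N/Q ≤ N/R ≤ R⁴/N²`), else
    `V = R⁴/N² ≥ 1`; `(a + b)^{1/2} ≤ a^{1/2} + b^{1/2}` splits `w⁶` into the `V`-part, bounded by
    `M^{11/2}NR^{-7/2}` resp. `M^{11/2}R^{-1}N^{-1/2}` times `C₀¹⁸C_AC₂L¹²N^{2ε₁}`
    (`caseB_w316_first_i/ii`; in either case this is the `min` of the two, by the case
    condition), and the `Δ₁Δ₂Δ₄^{2/3}`-part `≤ C₀¹⁸C_AC₂L¹²N^{2ε₁}(M⁶/N³)(N/R)^{2/3}`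
    (`caseB_w316_delta`); `u⁶, v⁶ ≪ M⁶L¹²N⁻³(N/R)^{2/3}` (`R ≤ N`), and `log_absorb` gives
    (3.16).
Step 6 and the optimisation in `N` are then `Bourgain2017_theorem4_log_of_eq312_of_eq316`.

## Faithfulness notes

* The hypotheses `h34`, `h311`, `h315` transcribe the displays (3.4) (with the constraints
  printed after (3.3)–(3.4) and the count of minor arcs), the display before (3.11), and (3.15),
  for `F = log` and a fixed `c ∈ (0, 1]` in (3.3); implied constants `≪` become `∃ C₀ T₀, ∀ T ≥ T₀`
  (uniform in `M, N` in the stated ranges). Where the paper's wording leaves the range implicit,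
  the hypotheses are asked only on the SMALLER range actually used (regime (3.6); `N = MT^{-2/7}`
  for (3.11); the two printed choices of `V` for (3.15), with the side condition `N/Q ≤ R⁴/N²` of
  the first), which makes them weaker. The two-sided "`H ≥ NQ/R² ≫ H`" and "`Q ≥ R`" are kept;
  "`R ≫ √Q`" and the residue class `ℓ` are not needed and not asked for.
* The data `Q, H, α, 𝓘, x` are arbitrary functions of `(T, M, N)`; nothing about the actual
  Huxley–Watt construction (`x(I) = 𝐲^{(k)}` of [H-W] §4 Step 4, "we skip the definition of
  `x(I)`", p. 10) is used beyond the three hypotheses. `𝓘` is a `Finset ℕ` (the arcs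
  `I = [kN, N+kN]` are indexed by `k`).
* `B₁`, `B_V` are `Literature.NumberTheory.LFunctions.bourgainSecondSpacingCount` (strict
  inequalities, as printed in (3.9) and before (3.14)).
* Nothing is asserted about [H-W] or [H1] themselves: the three hypotheses remain open inputs, as
  in the paper ("We use notation and background from [H] and also rely on [H-W] and §7 and §8 in
  [H1]", p. 10).

## References

* J. Bourgain, *Decoupling, exponential sums and the Riemann zeta function*, J. Amer. Math. Soc.
  30 (2017), 205–224, doi:10.1090/jams/860, arXiv:1408.5794 — §4, (3.3)–(3.19).
  [cite: BourgainJAMS2017, §4 eqs. (3.4)–(3.16), Theorem 4]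
* [H-W] M. N. Huxley, N. Watt, *Exponential sums and the Riemann zeta function*, Proc. London
  Math. Soc. (3) 57 (1988), 1–24 — §4, Lemma 2.1, the second spacing problem.
* [H1] M. N. Huxley, *Exponential sums and the Riemann zeta function IV*, Proc. London Math. Soc.
  (3) 66 (1993), 1–40 — §§7–8.
* [B-I1] E. Bombieri, H. Iwaniec, *On the order of `ζ(1/2+it)`*, Ann. Sc. Norm. Sup. Pisa 13
  (1986), 449–472. [cite: BombieriIwaniec1986, Lemma 2.4]
-/

noncomputable section

open Finset

namespace Literature.NumberTheory.LFunctions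

namespace BourgainTheorem4

/-! ## Analytic helpers -/

/-- `a ≤ b` for positive reals from the comparison of logarithms. [folklore] -/
theorem le_of_log_le_log {a b : ℝ} (ha : 0 < a) (hb : 0 < b) (h : Real.log a ≤ Real.log b) :
    a ≤ b :=
  (Real.log_le_log_iff ha hb).1 h

/-- `(log x)ⁿ ≤ (n/ε)ⁿ x^ε` for `x ≥ 1`, `ε > 0`, `n ≥ 1`. [folklore] -/
theorem log_pow_le_rpow {ε : ℝ} (hε : 0 < ε) {n : ℕ} (hn : n ≠ 0) {x : ℝ} (hx : 1 ≤ x) :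
    Real.log x ^ n ≤ ((n : ℝ) / ε) ^ n * x ^ ε := by
  have hx0 : 0 < x := by linarith
  have hn0 : (0 : ℝ) < n := by exact_mod_cast Nat.pos_of_ne_zero hn
  have h := Real.log_le_rpow_div hx0.le (div_pos hε hn0)
  have hlog : 0 ≤ Real.log x := Real.log_nonneg hx
  calc Real.log x ^ n ≤ (x ^ (ε / n) / (ε / n)) ^ n := pow_le_pow_left₀ hlog h n
    _ = ((n : ℝ) / ε) ^ n * x ^ ε := by
        have hεn : ε / n * (n / ε) = 1 := by field_simp
        rw [div_pow, ← Real.rpow_natCast (x ^ (ε / n)) n, ← Real.rpow_mul hx0.le,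
          div_mul_cancel₀ ε hn0.ne', div_eq_iff (by positivity), mul_comm, ← mul_assoc, ← mul_pow,
          hεn, one_pow, one_mul]

/-- `(a + b + c)⁶ ≤ 3⁵ (a⁶ + b⁶ + c⁶)` for `a, b, c ≥ 0`. [folklore] -/
theorem add_three_pow_six_le {a b c : ℝ} (ha : 0 ≤ a) (hb : 0 ≤ b) (hc : 0 ≤ c) :
    (a + b + c) ^ 6 ≤ 3 ^ 5 * (a ^ 6 + b ^ 6 + c ^ 6) := by
  have h := pow_sum_le_card_mul_sum_pow (s := Finset.univ) (f := ![a, b, c]) (by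
    intro i _
    fin_cases i
    · exact ha
    · exact hb
    · exact hc) 5
  simpa [Fin.sum_univ_three, add_assoc] using h

/-! ## Bookkeeping in the variables of §4: the case `Q ≥ R^{2/3} N^{1/3}` (trivial bound, (3.5)) -/

/-- **Case `Q ≥ R^{2/3}N^{1/3}` of (3.5)–(3.6)**: with the trivial bound `S₁ ≤ #𝓘 · H` for the
sum over the minor arcs, (3.4) gives `|S| ≤ 3C₀³ M (log N + log² N)/N^{1/2}`. Here `L = log N`,
`cI = #𝓘 ≤ C₀MR²/(NQ²)`, `H ≤ C₀NQ/R²`, `S₁ = ∑_I |∑_h …|`.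
[cite: BourgainJAMS2017, §4 eqs. (3.4)–(3.6)] -/
theorem caseA_bound {M N R Q H cI s S₁ C₀ L : ℝ} (hN : 1 ≤ N) (hR : 1 ≤ R) (hRN : R ≤ N)
    (hRQ : R ≤ Q) (hC₀ : 1 ≤ C₀) (hM : 0 < M) (hL : 0 < L) (hH0 : 0 ≤ H)
    (hH : H ≤ C₀ * N * Q / R ^ 2) (hI : cI ≤ C₀ * M * R ^ 2 / (N * Q ^ 2))
    (hS : S₁ ≤ cI * H)
    (h34 : s ≤ C₀ * (M * L / Real.sqrt N + R * L ^ 2 / Real.sqrt Q * (S₁ + cI * (Q / R))))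
    (hQ : R ^ (2 / 3 : ℝ) * N ^ (1 / 3 : ℝ) ≤ Q) :
    s ≤ 3 * C₀ ^ 3 * (M * (L + L ^ 2) / Real.sqrt N) := by
  have hN0 : 0 < N := by linarith
  have hR0 : 0 < R := by linarith
  have hQ0 : 0 < Q := by linarith
  have hC₀0 : 0 < C₀ := by linarith
  have lQ := Real.log_le_log (by positivity) hQ
  have lRN := Real.log_le_log hR0 hRN
  simp (disch := positivity) only [Real.log_mul, Real.log_rpow] at lQ
  -- (i) the main term with the trivial bound
  have h1 : R * L ^ 2 / Real.sqrt Q * S₁ ≤ C₀ ^ 2 * (M * L ^ 2 / Real.sqrt N) := by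
    calc R * L ^ 2 / Real.sqrt Q * S₁ ≤ R * L ^ 2 / Real.sqrt Q * (cI * H) := by gcongr
      _ ≤ R * L ^ 2 / Real.sqrt Q * (C₀ * M * R ^ 2 / (N * Q ^ 2) * (C₀ * N * Q / R ^ 2)) := by
          gcongr
      _ ≤ C₀ ^ 2 * (M * L ^ 2 / Real.sqrt N) := by
          apply le_of_log_le_log (by positivity) (by positivity)
          simp (disch := positivity) only [Real.log_mul, Real.log_div, Real.log_pow,
            Real.log_sqrt, Nat.cast_ofNat]
          linarith
  -- (ii) the term `Q/R`
  have h2 : R * L ^ 2 / Real.sqrt Q * (cI * (Q / R)) ≤ C₀ * (M * L ^ 2 / Real.sqrt N) := by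
    calc R * L ^ 2 / Real.sqrt Q * (cI * (Q / R))
        ≤ R * L ^ 2 / Real.sqrt Q * (C₀ * M * R ^ 2 / (N * Q ^ 2) * (Q / R)) := by gcongr
      _ ≤ C₀ * (M * L ^ 2 / Real.sqrt N) := by
          apply le_of_log_le_log (by positivity) (by positivity)
          simp (disch := positivity) only [Real.log_mul, Real.log_div, Real.log_pow,
            Real.log_sqrt, Nat.cast_ofNat]
          linarith
  -- combine
  set X₁ : ℝ := M * (L + L ^ 2) / Real.sqrt N with hX₁
  set X₂ : ℝ := M * L ^ 2 / Real.sqrt N with hX₂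
  have hX₂0 : 0 ≤ X₂ := by rw [hX₂]; positivity
  have hX₂X₁ : X₂ ≤ X₁ := by
    rw [hX₁, hX₂]
    gcongr
    nlinarith
  have hX₁0 : 0 ≤ X₁ := hX₂0.trans hX₂X₁
  have hLX : M * L / Real.sqrt N ≤ X₁ := by
    rw [hX₁]
    gcongr
    nlinarith
  have e1 : C₀ * X₁ ≤ C₀ ^ 3 * X₁ :=
    mul_le_mul_of_nonneg_right (by nlinarith) hX₁0
  have e2 : C₀ * (C₀ ^ 2 * X₂) ≤ C₀ ^ 3 * X₁ := by
    rw [← mul_assoc, ← pow_succ']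
    exact mul_le_mul_of_nonneg_left hX₂X₁ (by positivity)
  have e3 : C₀ * (C₀ * X₂) ≤ C₀ ^ 3 * X₁ := by
    rw [← mul_assoc, ← sq]
    exact mul_le_mul (pow_le_pow_right₀ hC₀ (by norm_num)) hX₂X₁ hX₂0 (by positivity)
  calc s ≤ C₀ * (M * L / Real.sqrt N + R * L ^ 2 / Real.sqrt Q * (S₁ + cI * (Q / R))) := h34
    _ = C₀ * (M * L / Real.sqrt N) + C₀ * (R * L ^ 2 / Real.sqrt Q * S₁) +
          C₀ * (R * L ^ 2 / Real.sqrt Q * (cI * (Q / R))) := by ring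
    _ ≤ C₀ * X₁ + C₀ * (C₀ ^ 2 * X₂) + C₀ * (C₀ * X₂) := by gcongr
    _ ≤ C₀ ^ 3 * X₁ + C₀ ^ 3 * X₁ + C₀ ^ 3 * X₁ := by linarith
    _ = 3 * C₀ ^ 3 * X₁ := by ring

/-- Sixth power of the case-A bound: `|S|⁶ ≤ 3⁶C₀¹⁸ · 2⁵ (L⁶ + L¹²) M⁶/N³`. [folklore] -/
theorem caseA_pow_six {M N s C₀ L : ℝ} (hN : 0 < N) (hM : 0 < M) (hL : 0 < L) (hC₀ : 1 ≤ C₀)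
    (hs : 0 ≤ s) (h : s ≤ 3 * C₀ ^ 3 * (M * (L + L ^ 2) / Real.sqrt N)) :
    s ^ 6 ≤ 3 ^ 6 * 2 ^ 5 * C₀ ^ 18 * (M ^ 6 * (L ^ 6 + L ^ 12) / N ^ 3) := by
  have hsN : Real.sqrt N ^ 6 = N ^ 3 := by
    rw [show (6 : ℕ) = 2 * 3 by norm_num, pow_mul, Real.sq_sqrt hN.le]
  have h6 : s ^ 6 ≤ (3 * C₀ ^ 3 * (M * (L + L ^ 2) / Real.sqrt N)) ^ 6 := pow_le_pow_left₀ hs h 6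
  have hL2 : (L + L ^ 2) ^ 6 ≤ 2 ^ 5 * (L ^ 6 + L ^ 12) := by
    have := pow_sum_le_card_mul_sum_pow (s := Finset.univ) (f := ![L, L ^ 2]) (by
      intro i _
      fin_cases i
      · exact hL.le
      · exact (sq_nonneg L)) 5
    simpa [Fin.sum_univ_two, ← pow_mul] using this
  calc s ^ 6 ≤ (3 * C₀ ^ 3 * (M * (L + L ^ 2) / Real.sqrt N)) ^ 6 := h6
    _ = 3 ^ 6 * C₀ ^ 18 * (M ^ 6 * (L + L ^ 2) ^ 6 / N ^ 3) := by
        rw [mul_pow, mul_pow, div_pow, mul_pow, hsN, ← pow_mul]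
    _ ≤ 3 ^ 6 * C₀ ^ 18 * (M ^ 6 * (2 ^ 5 * (L ^ 6 + L ^ 12)) / N ^ 3) := by gcongr
    _ = 3 ^ 6 * 2 ^ 5 * C₀ ^ 18 * (M ^ 6 * (L ^ 6 + L ^ 12) / N ^ 3) := by ring

/-! ## The case `Q < R^{2/3}N^{1/3}` ((3.6)): Hölder and the split into three terms -/

/-- **(3.6)–(3.7), Hölder**: if `|S| ≤ C₀(ML/√N + (RL²/√Q)(S₁ + #𝓘·Q/R))` (3.4) and
`S₁⁶ ≤ #𝓘⁵ S₆` (sixth-power Hölder over the minor arcs, `S₆ = ∑_I |∑_h …|⁶`), then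
`|S|⁶ ≤ 3⁵ (C₀⁶ M⁶L⁶/N³ + C₀¹² M⁶L¹²/(N²R) + C₀⁶ (R⁶L¹²/Q³) #𝓘⁵ S₆)`, using `#𝓘 ≤ C₀MR²/(NQ²)`,
`R ≤ Q`, `R ≤ N` for the middle (`Q/R`) term. [cite: BourgainJAMS2017, §4 eqs. (3.5)–(3.7)] -/
theorem caseB_split {M N R Q cI s S₁ S₆ C₀ L : ℝ} (hN : 1 ≤ N) (hR : 1 ≤ R) (hRN : R ≤ N)
    (hRQ : R ≤ Q) (hC₀ : 1 ≤ C₀) (hM : 0 < M) (hL : 0 < L) (hs : 0 ≤ s) (hI0 : 0 ≤ cI)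
    (hI : cI ≤ C₀ * M * R ^ 2 / (N * Q ^ 2)) (hS0 : 0 ≤ S₁)
    (hHolder : S₁ ^ 6 ≤ cI ^ 5 * S₆)
    (h34 : s ≤ C₀ * (M * L / Real.sqrt N + R * L ^ 2 / Real.sqrt Q * (S₁ + cI * (Q / R)))) :
    s ^ 6 ≤ 3 ^ 5 * (C₀ ^ 6 * (M ^ 6 * L ^ 6 / N ^ 3) + C₀ ^ 12 * (M ^ 6 * L ^ 12 * R ^ 3 / N ^ 6) +
      C₀ ^ 6 * (R ^ 6 * L ^ 12 / Q ^ 3) * (cI ^ 5 * S₆)) := by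
  have hN0 : 0 < N := by linarith
  have hR0 : 0 < R := by linarith
  have hQ0 : 0 < Q := by linarith
  have hC₀0 : 0 < C₀ := by linarith
  have lRN := Real.log_le_log hR0 hRN
  have lRQ := Real.log_le_log hR0 hRQ
  have hsN : Real.sqrt N ^ 6 = N ^ 3 := by
    rw [show (6 : ℕ) = 2 * 3 by norm_num, pow_mul, Real.sq_sqrt hN0.le]
  have hsQ : Real.sqrt Q ^ 6 = Q ^ 3 := by
    rw [show (6 : ℕ) = 2 * 3 by norm_num, pow_mul, Real.sq_sqrt hQ0.le]
  set u : ℝ := C₀ * (M * L / Real.sqrt N) with hu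
  set v : ℝ := C₀ * (R * L ^ 2 / Real.sqrt Q * (cI * (Q / R))) with hv
  set w : ℝ := C₀ * (R * L ^ 2 / Real.sqrt Q * S₁) with hw
  have hu0 : 0 ≤ u := by rw [hu]; positivity
  have hv0 : 0 ≤ v := by rw [hv]; positivity
  have hw0 : 0 ≤ w := by rw [hw]; positivity
  have hsum : s ≤ u + v + w := by
    calc s ≤ _ := h34
      _ = u + v + w := by rw [hu, hv, hw]; ring
  have hu6 : u ^ 6 = C₀ ^ 6 * (M ^ 6 * L ^ 6 / N ^ 3) := by
    rw [hu, mul_pow, div_pow, mul_pow, hsN]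
  have hv6 : v ^ 6 ≤ C₀ ^ 12 * (M ^ 6 * L ^ 12 * R ^ 3 / N ^ 6) := by
    calc v ^ 6 ≤ (C₀ * (R * L ^ 2 / Real.sqrt Q * (C₀ * M * R ^ 2 / (N * Q ^ 2) * (Q / R)))) ^ 6 := by
          apply pow_le_pow_left₀ hv0
          rw [hv]
          gcongr
      _ ≤ C₀ ^ 12 * (M ^ 6 * L ^ 12 * R ^ 3 / N ^ 6) := by
          apply le_of_log_le_log (by positivity) (by positivity)
          simp (disch := positivity) only [Real.log_mul, Real.log_div, Real.log_pow,
            Real.log_sqrt, Nat.cast_ofNat]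
          linarith
  have hw6 : w ^ 6 ≤ C₀ ^ 6 * (R ^ 6 * L ^ 12 / Q ^ 3) * (cI ^ 5 * S₆) := by
    have e : w ^ 6 = C₀ ^ 6 * (R ^ 6 * L ^ 12 / Q ^ 3) * S₁ ^ 6 := by
      rw [hw, mul_pow, mul_pow, div_pow, mul_pow, hsQ]; ring
    rw [e]
    exact mul_le_mul_of_nonneg_left hHolder (by positivity)
  calc s ^ 6 ≤ (u + v + w) ^ 6 := pow_le_pow_left₀ hs hsum 6
    _ ≤ 3 ^ 5 * (u ^ 6 + v ^ 6 + w ^ 6) := add_three_pow_six_le hu0 hv0 hw0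
    _ ≤ 3 ^ 5 * (C₀ ^ 6 * (M ^ 6 * L ^ 6 / N ^ 3) + C₀ ^ 12 * (M ^ 6 * L ^ 12 * R ^ 3 / N ^ 6) +
          C₀ ^ 6 * (R ^ 6 * L ^ 12 / Q ^ 3) * (cI ^ 5 * S₆)) := by
        rw [hu6]
        gcongr

/-! ## The case (3.6): standing inequalities between the parameters -/

/-- The standing inequalities between the parameters of §4 in the case (3.6)
(`R ≤ Q < R^{2/3}N^{1/3} ≤ N`): `1 ≤ R ≤ Q ≤ N`, `M > 0`, `NQ/R² ≤ H ≤ C₀NQ/R²`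
("`H ≥ NQ/R² ≫ H`"), a constant `C₀ ≥ 1`, and an auxiliary exponent `0 < ε₁ ≤ 1`.
[cite: BourgainJAMS2017, §4, (3.3)–(3.6) and the constraints after (3.3)] -/
structure Params (M N R Q H C₀ ε₁ : ℝ) : Prop where
  one_le_R : 1 ≤ R
  R_le_Q : R ≤ Q
  Q_le_N : Q ≤ N
  R_le_N : R ≤ N
  M_pos : 0 < M
  one_le_C₀ : 1 ≤ C₀
  H_lower : N * Q / R ^ 2 ≤ H
  H_upper : H ≤ C₀ * N * Q / R ^ 2
  ε₁_pos : 0 < ε₁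
  ε₁_le_one : ε₁ ≤ 1

namespace Params

variable {M N R Q H C₀ ε₁ : ℝ} (hp : Params M N R Q H C₀ ε₁)
include hp

/-- [folklore] -/ theorem R_pos : 0 < R := by linarith [hp.one_le_R]
/-- [folklore] -/ theorem Q_pos : 0 < Q := by linarith [hp.one_le_R, hp.R_le_Q]
/-- [folklore] -/ theorem N_pos : 0 < N := by linarith [hp.one_le_R, hp.R_le_N]
/-- [folklore] -/ theorem one_le_N : 1 ≤ N := by linarith [hp.one_le_R, hp.R_le_N]
/-- [folklore] -/ theorem C₀_pos : 0 < C₀ := by linarith [hp.one_le_C₀]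
/-- [folklore] -/ theorem H_pos : 0 < H := by
  have := hp.H_lower
  have h : 0 < N * Q / R ^ 2 := by
    have := hp.N_pos; have := hp.Q_pos; have := hp.R_pos; positivity
  linarith
/-- [folklore] -/ theorem log_R_nonneg : 0 ≤ Real.log R := Real.log_nonneg hp.one_le_R
/-- [folklore] -/ theorem log_C₀_nonneg : 0 ≤ Real.log C₀ := Real.log_nonneg hp.one_le_C₀
/-- [folklore] -/ theorem log_R_le_log_Q : Real.log R ≤ Real.log Q := Real.log_le_log hp.R_pos hp.R_le_Q
/-- [folklore] -/ theorem log_Q_le_log_N : Real.log Q ≤ Real.log N := Real.log_le_log hp.Q_pos hp.Q_le_N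
/-- [folklore] -/ theorem log_R_le_log_N : Real.log R ≤ Real.log N := Real.log_le_log hp.R_pos hp.R_le_N
/-- `log H ≤ log C₀ + log N + log Q - 2 log R`. [folklore] -/
theorem log_H_le : Real.log H ≤ Real.log C₀ + Real.log N + Real.log Q - 2 * Real.log R := by
  have := hp.N_pos; have := hp.Q_pos; have := hp.R_pos; have := hp.C₀_pos
  have l := Real.log_le_log hp.H_pos hp.H_upper
  simp (disch := positivity) only [Real.log_mul, Real.log_div, Real.log_pow, Nat.cast_ofNat] at l
  linarith
/-- `log N + log Q - 2 log R ≤ log H`. [folklore] -/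
theorem le_log_H : Real.log N + Real.log Q - 2 * Real.log R ≤ Real.log H := by
  have := hp.N_pos; have := hp.Q_pos; have := hp.R_pos
  have l := Real.log_le_log (by positivity) hp.H_lower
  simp (disch := positivity) only [Real.log_mul, Real.log_div, Real.log_pow, Nat.cast_ofNat] at l
  linarith
/-- The auxiliary products with `ε₁` used by `linarith`: `ε₁ log Q ≤ ε₁ log N`, `0 ≤ ε₁ log R`,
`ε₁ log C₀ ≤ log C₀`, and `(a + ε₁) log H ≤ (a + ε₁)(log C₀ + log N + log Q - 2 log R)` for
`a + ε₁ ≥ 0`. [folklore] -/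
theorem eps_aux {a : ℝ} (ha : 0 ≤ a + ε₁) :
    ε₁ * Real.log Q ≤ ε₁ * Real.log N ∧ 0 ≤ ε₁ * Real.log R ∧ ε₁ * Real.log C₀ ≤ Real.log C₀ ∧
    (a + ε₁) * Real.log H ≤ (a + ε₁) * (Real.log C₀ + Real.log N + Real.log Q - 2 * Real.log R) :=
  ⟨mul_le_mul_of_nonneg_left hp.log_Q_le_log_N hp.ε₁_pos.le,
   mul_nonneg hp.ε₁_pos.le hp.log_R_nonneg,
   mul_le_of_le_one_left hp.log_C₀_nonneg hp.ε₁_le_one,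
   mul_le_mul_of_nonneg_left hp.log_H_le ha⟩

end Params

/-! ## The case (3.6): the main term with (3.10) and the second spacing bounds -/

/-- **(3.8)–(3.11) ⇒ (3.12), the main term.** With `#𝓘 ≤ C₀MR²/(NQ²)`, the sixth-moment bound
`Σ₆ ≤ C_A H^{6+ε₁} B₁^{1/2}` ((3.8) + (3.10), `BourgainTheorem4SixthMoment.lean`) and Huxley–Watt's
second spacing bound `B₁ ≤ C₁ Δ₁Δ₂ (M/N)² (Q/R)⁴`, `Δ₁ = 1/(3H²)`, `Δ₂ = Q²/(6R²H²)` (the display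
before (3.11)), the main term `C₀⁶ (R⁶L¹²/Q³) #𝓘⁵ Σ₆` of `caseB_split` is at most
`C₀¹⁶ C_A C₁ · L¹² N^{2ε₁} · M⁶/(N²R)` — the paper's
"`(M^{5+ε}R⁴N/Q⁷)(MRQ/N³) ≤ (M^{6+ε}/N³)(N/R)`" of (3.12), with `L¹² N^{2ε₁}` in place of `M^ε`.
[cite: BourgainJAMS2017, §4 eqs. (3.8)–(3.12)] -/
theorem caseB_w312 {M N R Q H cI S₆ B C₀ CA C₁ L ε₁ : ℝ} (hp : Params M N R Q H C₀ ε₁)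
    (hCA : 1 ≤ CA) (hC₁ : 1 ≤ C₁) (hL : 0 < L)
    (hI0 : 0 ≤ cI) (hI : cI ≤ C₀ * M * R ^ 2 / (N * Q ^ 2)) (hS₆0 : 0 ≤ S₆)
    (hS₆ : S₆ ≤ CA * H ^ (6 + ε₁) * Real.sqrt B)
    (hB : B ≤ C₁ * (1 / (3 * H ^ 2)) * (Q ^ 2 / (6 * R ^ 2 * H ^ 2)) * (M / N) ^ 2 * (Q / R) ^ 4) :
    C₀ ^ 6 * (R ^ 6 * L ^ 12 / Q ^ 3) * (cI ^ 5 * S₆) ≤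
      C₀ ^ 16 * CA * C₁ * (L ^ 12 * N ^ (2 * ε₁) * (M ^ 6 / (N ^ 2 * R))) := by
  have hN := hp.N_pos; have hR := hp.R_pos; have hQ := hp.Q_pos; have hH := hp.H_pos
  have hM := hp.M_pos; have hC₀ := hp.C₀_pos
  have hCA0 : 0 < CA := by linarith
  have hC₁0 : 0 < C₁ := by linarith
  obtain ⟨a2, a3, a4, a1⟩ := hp.eps_aux (a := 4) (by linarith [hp.ε₁_pos])
  have lRQ := hp.log_R_le_log_Q
  have lRN := hp.log_R_le_log_N
  have l3 : 0 ≤ Real.log 3 := Real.log_nonneg (by norm_num)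
  have l6 : 0 ≤ Real.log 6 := Real.log_nonneg (by norm_num)
  have lCA : 0 ≤ Real.log CA := Real.log_nonneg hCA
  have lC₁ : 0 ≤ Real.log C₁ := Real.log_nonneg hC₁
  calc C₀ ^ 6 * (R ^ 6 * L ^ 12 / Q ^ 3) * (cI ^ 5 * S₆)
      ≤ C₀ ^ 6 * (R ^ 6 * L ^ 12 / Q ^ 3) *
          ((C₀ * M * R ^ 2 / (N * Q ^ 2)) ^ 5 * (CA * H ^ (6 + ε₁) * Real.sqrt B)) := by gcongr
    _ ≤ C₀ ^ 6 * (R ^ 6 * L ^ 12 / Q ^ 3) * ((C₀ * M * R ^ 2 / (N * Q ^ 2)) ^ 5 *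
          (CA * H ^ (6 + ε₁) * Real.sqrt (C₁ * (1 / (3 * H ^ 2)) * (Q ^ 2 / (6 * R ^ 2 * H ^ 2)) *
            (M / N) ^ 2 * (Q / R) ^ 4))) := by gcongr
    _ ≤ C₀ ^ 16 * CA * C₁ * (L ^ 12 * N ^ (2 * ε₁) * (M ^ 6 / (N ^ 2 * R))) := by
        apply le_of_log_le_log (by positivity) (by positivity)
        simp (disch := positivity) only [Real.log_mul, Real.log_div, Real.log_pow, Real.log_rpow,
          Real.log_sqrt, Real.log_one, Nat.cast_ofNat]
        nlinarith [a1, a2, a3, a4, lRQ, lRN, l3, l6, lCA, lC₁]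

/-- The common prefactor of the main term in the case of Huxley's bound (3.15):
`C₀⁶ (R⁶L¹²/Q³) #𝓘⁵ Σ₆ ≤ P · (√(C₂(Q/R)⁴ · VMR²/(NQ²)) + √(C₂(Q/R)⁴ · Δ₁Δ₂Δ₄^{2/3}(M/N)²))`,
`P = C₀⁶ (R⁶L¹²/Q³) (C₀MR²/(NQ²))⁵ C_A H^{6+ε₁}`, from `Σ₆ ≤ C_A H^{6+ε₁} (VB_V)^{1/2}` and (3.15).
[cite: BourgainJAMS2017, §4 eqs. (3.14)–(3.16)] -/
theorem caseB_w316_prefix {M N R Q H cI S₆ VB V C₀ CA C₂ L ε₁ : ℝ} (hp : Params M N R Q H C₀ ε₁)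
    (hCA : 1 ≤ CA) (hC₂ : 1 ≤ C₂) (hL : 0 < L) (hV : 0 ≤ V)
    (hI0 : 0 ≤ cI) (hI : cI ≤ C₀ * M * R ^ 2 / (N * Q ^ 2)) (hS₆0 : 0 ≤ S₆)
    (hS₆ : S₆ ≤ CA * H ^ (6 + ε₁) * Real.sqrt VB)
    (hVB : VB ≤ C₂ * (V * M * R ^ 2 / (N * Q ^ 2) +
      (1 / (3 * H ^ 2)) * (Q ^ 2 / (6 * R ^ 2 * H ^ 2)) * (Q ^ 2 / (6 * R ^ 2 * H)) ^ (2 / 3 : ℝ) *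
        (M / N) ^ 2) * (Q / R) ^ 4) :
    C₀ ^ 6 * (R ^ 6 * L ^ 12 / Q ^ 3) * (cI ^ 5 * S₆) ≤
      C₀ ^ 6 * (R ^ 6 * L ^ 12 / Q ^ 3) * ((C₀ * M * R ^ 2 / (N * Q ^ 2)) ^ 5 *
        (CA * H ^ (6 + ε₁))) *
        (Real.sqrt (C₂ * (Q / R) ^ 4 * (V * M * R ^ 2 / (N * Q ^ 2))) +
          Real.sqrt (C₂ * (Q / R) ^ 4 * ((1 / (3 * H ^ 2)) * (Q ^ 2 / (6 * R ^ 2 * H ^ 2)) *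
            (Q ^ 2 / (6 * R ^ 2 * H)) ^ (2 / 3 : ℝ) * (M / N) ^ 2))) := by
  have hN := hp.N_pos; have hR := hp.R_pos; have hQ := hp.Q_pos; have hH := hp.H_pos
  have hM := hp.M_pos; have hC₀ := hp.C₀_pos
  have hCA0 : 0 < CA := by linarith
  have hC₂0 : 0 < C₂ := by linarith
  have hsq : Real.sqrt VB ≤ Real.sqrt (C₂ * (Q / R) ^ 4 * (V * M * R ^ 2 / (N * Q ^ 2))) +
      Real.sqrt (C₂ * (Q / R) ^ 4 * ((1 / (3 * H ^ 2)) * (Q ^ 2 / (6 * R ^ 2 * H ^ 2)) *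
        (Q ^ 2 / (6 * R ^ 2 * H)) ^ (2 / 3 : ℝ) * (M / N) ^ 2)) := by
    refine (Real.sqrt_le_sqrt hVB).trans ?_
    rw [show C₂ * (V * M * R ^ 2 / (N * Q ^ 2) +
        (1 / (3 * H ^ 2)) * (Q ^ 2 / (6 * R ^ 2 * H ^ 2)) * (Q ^ 2 / (6 * R ^ 2 * H)) ^ (2 / 3 : ℝ) *
          (M / N) ^ 2) * (Q / R) ^ 4 =
        C₂ * (Q / R) ^ 4 * (V * M * R ^ 2 / (N * Q ^ 2)) +
          C₂ * (Q / R) ^ 4 * ((1 / (3 * H ^ 2)) * (Q ^ 2 / (6 * R ^ 2 * H ^ 2)) *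
            (Q ^ 2 / (6 * R ^ 2 * H)) ^ (2 / 3 : ℝ) * (M / N) ^ 2) by ring]
    -- `√(a + b) ≤ √a + √b`
    have hsub : ∀ a b : ℝ, 0 ≤ a → 0 ≤ b → Real.sqrt (a + b) ≤ Real.sqrt a + Real.sqrt b := by
      intro a b ha hb
      have h0 : 0 ≤ Real.sqrt a + Real.sqrt b := by positivity
      calc Real.sqrt (a + b) ≤ Real.sqrt ((Real.sqrt a + Real.sqrt b) ^ 2) := by
            apply Real.sqrt_le_sqrt
            rw [add_sq, Real.sq_sqrt ha, Real.sq_sqrt hb]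
            nlinarith [Real.sqrt_nonneg a, Real.sqrt_nonneg b]
        _ = Real.sqrt a + Real.sqrt b := Real.sqrt_sq h0
    exact hsub _ _ (by positivity) (by positivity)
  calc C₀ ^ 6 * (R ^ 6 * L ^ 12 / Q ^ 3) * (cI ^ 5 * S₆)
      ≤ C₀ ^ 6 * (R ^ 6 * L ^ 12 / Q ^ 3) *
          ((C₀ * M * R ^ 2 / (N * Q ^ 2)) ^ 5 * (CA * H ^ (6 + ε₁) * Real.sqrt VB)) := by gcongr
    _ ≤ C₀ ^ 6 * (R ^ 6 * L ^ 12 / Q ^ 3) * ((C₀ * M * R ^ 2 / (N * Q ^ 2)) ^ 5 *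
          (CA * H ^ (6 + ε₁) * (Real.sqrt (C₂ * (Q / R) ^ 4 * (V * M * R ^ 2 / (N * Q ^ 2))) +
          Real.sqrt (C₂ * (Q / R) ^ 4 * ((1 / (3 * H ^ 2)) * (Q ^ 2 / (6 * R ^ 2 * H ^ 2)) *
            (Q ^ 2 / (6 * R ^ 2 * H)) ^ (2 / 3 : ℝ) * (M / N) ^ 2))))) := by gcongr
    _ = _ := by ring

/-- The `Δ₁Δ₂Δ₄^{2/3}` part of (3.16): `P √(C₂(Q/R)⁴ Δ₁Δ₂Δ₄^{2/3}(M/N)²) ≤ C₀¹⁸C_AC₂ L¹²N^{2ε₁} ·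
(M⁶/N³)(N/R)^{2/3}` (the paper: "`(M^{5+ε}R⁴N/Q⁷)(Q/R)^{1/3}(R/N)^{7/3}(M/N) ≤ (M^{6+ε}/N³)(N/R)^{2/3}`",
using `Δ₁ < R⁴/(N²Q²)`, `Δ₂ < R²/N²`, `Δ₄ < Q/N`, i.e. `H ≥ NQ/R²`, and `Q ≥ R`).
[cite: BourgainJAMS2017, §4 eqs. (3.15)–(3.16)] -/
theorem caseB_w316_delta {M N R Q H C₀ CA C₂ L ε₁ : ℝ} (hp : Params M N R Q H C₀ ε₁)
    (hCA : 1 ≤ CA) (hC₂ : 1 ≤ C₂) (hL : 0 < L) :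
    C₀ ^ 6 * (R ^ 6 * L ^ 12 / Q ^ 3) * ((C₀ * M * R ^ 2 / (N * Q ^ 2)) ^ 5 *
        (CA * H ^ (6 + ε₁))) *
        Real.sqrt (C₂ * (Q / R) ^ 4 * ((1 / (3 * H ^ 2)) * (Q ^ 2 / (6 * R ^ 2 * H ^ 2)) *
          (Q ^ 2 / (6 * R ^ 2 * H)) ^ (2 / 3 : ℝ) * (M / N) ^ 2)) ≤
      C₀ ^ 18 * CA * C₂ * (L ^ 12 * N ^ (2 * ε₁)) * (M ^ 6 / N ^ 3 * (N / R) ^ (2 / 3 : ℝ)) := by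
  have hN := hp.N_pos; have hR := hp.R_pos; have hQ := hp.Q_pos; have hH := hp.H_pos
  have hM := hp.M_pos; have hC₀ := hp.C₀_pos
  have hCA0 : 0 < CA := by linarith
  have hC₂0 : 0 < C₂ := by linarith
  obtain ⟨a2, a3, a4, a1⟩ := hp.eps_aux (a := 11 / 3) (by linarith [hp.ε₁_pos])
  have lRQ := hp.log_R_le_log_Q
  have lRN := hp.log_R_le_log_N
  have lC₀ := hp.log_C₀_nonneg
  have l3 : 0 ≤ Real.log 3 := Real.log_nonneg (by norm_num)
  have l6 : 0 ≤ Real.log 6 := Real.log_nonneg (by norm_num)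
  have lCA : 0 ≤ Real.log CA := Real.log_nonneg hCA
  have lC₂ : 0 ≤ Real.log C₂ := Real.log_nonneg hC₂
  apply le_of_log_le_log (by positivity) (by positivity)
  simp (disch := positivity) only [Real.log_mul, Real.log_div, Real.log_pow, Real.log_rpow,
    Real.log_sqrt, Real.log_one, Nat.cast_ofNat]
  nlinarith [a1, a2, a3, a4, lRQ, lRN, l3, l6, lCA, lC₂, lC₀]

/-- The `V`-part of (3.16) for `V = N/Q`: `P √(C₂(Q/R)⁴ (N/Q)MR²/(NQ²)) ≤ C₀¹⁸C_AC₂ L¹²N^{2ε₁} ·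
M^{11/2} N R^{-7/2}` ("`(M^{5+ε}R⁴N/Q⁷)(N/Q)^{1/2}(M/N)^{1/2} ≤ M^{ε+11/2}N R^{-7/2}`").
[cite: BourgainJAMS2017, §4 eqs. (3.15)–(3.16)] -/
theorem caseB_w316_first_i {M N R Q H C₀ CA C₂ L ε₁ : ℝ} (hp : Params M N R Q H C₀ ε₁)
    (hCA : 1 ≤ CA) (hC₂ : 1 ≤ C₂) (hL : 0 < L) :
    C₀ ^ 6 * (R ^ 6 * L ^ 12 / Q ^ 3) * ((C₀ * M * R ^ 2 / (N * Q ^ 2)) ^ 5 *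
        (CA * H ^ (6 + ε₁))) *
        Real.sqrt (C₂ * (Q / R) ^ 4 * ((N / Q) * M * R ^ 2 / (N * Q ^ 2))) ≤
      C₀ ^ 18 * CA * C₂ * (L ^ 12 * N ^ (2 * ε₁)) * (M ^ (11 / 2 : ℝ) * N / R ^ (7 / 2 : ℝ)) := by
  have hN := hp.N_pos; have hR := hp.R_pos; have hQ := hp.Q_pos; have hH := hp.H_pos
  have hM := hp.M_pos; have hC₀ := hp.C₀_pos
  have hCA0 : 0 < CA := by linarith
  have hC₂0 : 0 < C₂ := by linarith
  obtain ⟨a2, a3, a4, a1⟩ := hp.eps_aux (a := 6) (by linarith [hp.ε₁_pos])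
  have lRQ := hp.log_R_le_log_Q
  have lRN := hp.log_R_le_log_N
  have lC₀ := hp.log_C₀_nonneg
  have lCA : 0 ≤ Real.log CA := Real.log_nonneg hCA
  have lC₂ : 0 ≤ Real.log C₂ := Real.log_nonneg hC₂
  apply le_of_log_le_log (by positivity) (by positivity)
  simp (disch := positivity) only [Real.log_mul, Real.log_div, Real.log_pow, Real.log_rpow,
    Real.log_sqrt, Nat.cast_ofNat]
  nlinarith [a1, a2, a3, a4, lRQ, lRN, lCA, lC₂, lC₀]

/-- The `V`-part of (3.16) for `V = R⁴/N²`: `P √(C₂(Q/R)⁴ (R⁴/N²)MR²/(NQ²)) ≤ C₀¹⁸C_AC₂ L¹²N^{2ε₁} ·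
M^{11/2} R⁻¹ N^{-1/2}` ("`(M^{5+ε}R⁴N/Q⁷)(R²/N)(M/N)^{1/2} ≤ M^{ε+11/2}R⁻¹N^{-1/2}`").
[cite: BourgainJAMS2017, §4 eqs. (3.15)–(3.16)] -/
theorem caseB_w316_first_ii {M N R Q H C₀ CA C₂ L ε₁ : ℝ} (hp : Params M N R Q H C₀ ε₁)
    (hCA : 1 ≤ CA) (hC₂ : 1 ≤ C₂) (hL : 0 < L) :
    C₀ ^ 6 * (R ^ 6 * L ^ 12 / Q ^ 3) * ((C₀ * M * R ^ 2 / (N * Q ^ 2)) ^ 5 *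
        (CA * H ^ (6 + ε₁))) *
        Real.sqrt (C₂ * (Q / R) ^ 4 * ((R ^ 4 / N ^ 2) * M * R ^ 2 / (N * Q ^ 2))) ≤
      C₀ ^ 18 * CA * C₂ * (L ^ 12 * N ^ (2 * ε₁)) *
        (M ^ (11 / 2 : ℝ) / (R * N ^ (1 / 2 : ℝ))) := by
  have hN := hp.N_pos; have hR := hp.R_pos; have hQ := hp.Q_pos; have hH := hp.H_pos
  have hM := hp.M_pos; have hC₀ := hp.C₀_pos
  have hCA0 : 0 < CA := by linarith
  have hC₂0 : 0 < C₂ := by linarith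
  obtain ⟨a2, a3, a4, a1⟩ := hp.eps_aux (a := 6) (by linarith [hp.ε₁_pos])
  have lRQ := hp.log_R_le_log_Q
  have lRN := hp.log_R_le_log_N
  have lC₀ := hp.log_C₀_nonneg
  have lCA : 0 ≤ Real.log CA := Real.log_nonneg hCA
  have lC₂ : 0 ≤ Real.log C₂ := Real.log_nonneg hC₂
  apply le_of_log_le_log (by positivity) (by positivity)
  simp (disch := positivity) only [Real.log_mul, Real.log_div, Real.log_pow, Real.log_rpow,
    Real.log_sqrt, Nat.cast_ofNat]
  nlinarith [a1, a2, a3, a4, lRQ, lRN, lCA, lC₂, lC₀]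

/-! ## Absorbing the logarithms, the trivial bound, and the pointwise form of case (3.6) -/

/-- Absorption of the logarithms into `M^ε`: for `1 < N ≤ M`, `0 < ε`, `4ε₁ ≤ ε`,
`L⁶ ≤ (6/ε)⁶M^ε`, `L¹² ≤ (12/ε)¹²M^ε` and `L¹²N^{2ε₁} ≤ (24/ε)¹²M^ε` (`L = log N`). [folklore] -/
theorem log_absorb {N M ε ε₁ : ℝ} (hN : 1 < N) (hNM : N ≤ M) (hε : 0 < ε)
    (h4 : 4 * ε₁ ≤ ε) :
    Real.log N ^ 6 ≤ (6 / ε) ^ 6 * M ^ ε ∧ Real.log N ^ 12 ≤ (12 / ε) ^ 12 * M ^ ε ∧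
      Real.log N ^ 12 * N ^ (2 * ε₁) ≤ (24 / ε) ^ 12 * M ^ ε := by
  have hN1 : 1 ≤ N := hN.le
  have hN0 : 0 < N := by linarith
  have hNM' : N ^ ε ≤ M ^ ε := Real.rpow_le_rpow hN0.le hNM hε.le
  refine ⟨?_, ?_, ?_⟩
  · have h := log_pow_le_rpow hε (n := 6) (by norm_num) hN1
    push_cast at h
    calc Real.log N ^ 6 ≤ (6 / ε) ^ 6 * N ^ ε := h
      _ ≤ (6 / ε) ^ 6 * M ^ ε := by gcongr
  · have h := log_pow_le_rpow hε (n := 12) (by norm_num) hN1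
    push_cast at h
    calc Real.log N ^ 12 ≤ (12 / ε) ^ 12 * N ^ ε := h
      _ ≤ (12 / ε) ^ 12 * M ^ ε := by gcongr
  · have h := log_pow_le_rpow (half_pos hε) (n := 12) (by norm_num) hN1
    push_cast at h
    have h2 : N ^ (2 * ε₁) ≤ N ^ (ε / 2) := Real.rpow_le_rpow_of_exponent_le hN1 (by linarith)
    have h12 : (12 : ℝ) / (ε / 2) = 24 / ε := by field_simp; ring
    rw [h12] at h
    have hl0 : 0 ≤ Real.log N ^ 12 := pow_nonneg (Real.log_nonneg hN1) _
    calc Real.log N ^ 12 * N ^ (2 * ε₁) ≤ (24 / ε) ^ 12 * N ^ (ε / 2) * N ^ (ε / 2) :=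
          mul_le_mul h h2 (by positivity) (by positivity)
      _ = (24 / ε) ^ 12 * N ^ ε := by
          rw [mul_assoc, ← Real.rpow_add hN0]; ring_nf
      _ ≤ (24 / ε) ^ 12 * M ^ ε := by gcongr

/-- The trivial bound for the inner sum of (3.4): `|∑_{h ≤ H} αʰ e(…)| ≤ H` for `|α| ≤ 1`.
[cite: BourgainJAMS2017, §4, "the trivial upper bound for the modulus of the sum over `h` in (3.4)"] -/
theorem norm_bourgainHSum_le (H : ℕ) {α : ℂ} (hα : ‖α‖ ≤ 1) (x : Fin 4 → ℝ) :
    ‖bourgainHSum H α x‖ ≤ H := by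
  unfold bourgainHSum
  calc ‖∑ h ∈ Finset.Icc 1 H, α ^ h * VdC.e (∑ k, x k * bourgainMonomials h k)‖
      ≤ ∑ h ∈ Finset.Icc 1 H, ‖α ^ h * VdC.e (∑ k, x k * bourgainMonomials h k)‖ := norm_sum_le _ _
    _ ≤ ∑ _h ∈ Finset.Icc 1 H, (1 : ℝ) := Finset.sum_le_sum fun h _ => by
        rw [norm_mul, VdC.norm_e, mul_one, norm_pow]
        exact pow_le_one₀ (norm_nonneg _) hα
    _ = H := by simp

/-- **Case (3.6) at one point `(T, M, N)`.** Given the data and the inequalities of (3.4) at a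
point (`R ≤ Q`, `NQ/R² ≤ H ≤ C₀NQ/R²`, `#𝓘 ≤ C₀MR²/(NQ²)`, `|α| ≤ 1`, `x(I)` in the box with
`X₃ = (R/Q)²H^{1/2}`, and the bound (3.4) for `s = |S|`), in the regime `Q < R^{2/3}N^{1/3}`:
the standing inequalities `Params` hold, `|S|⁶ ≤ 3⁵(u⁶ + v⁶ + C₀⁶(R⁶L¹²/Q³)#𝓘⁵Σ₆)` ((3.7)), and
`Σ₆ ≤ C_A H^{6+ε₁}(VB_V)^{1/2}` for every `V ≥ 1` ((3.8) + (3.10) + (3.14), from the conclusion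
`hCA` of `Bourgain2017_sixthMoment_of_corollary3`, since `H^{-1/2} ≤ X₃ ≤ H^{1/2}`).
[cite: BourgainJAMS2017, §4 eqs. (3.6)–(3.10), (3.14)] -/
theorem caseB_pointwise {M N R s C₀ CA ε₁ : ℝ} {Q₀ H₀ : ℕ} {α₀ : ℂ} {𝓘₀ : Finset ℕ}
    {x₀ : ℕ → Fin 4 → ℝ} (hN : 1 < N) (hNM : N < M) (hR : 1 ≤ R) (hRN : R ≤ N)
    (hC₀ : 1 ≤ C₀) (hε₁ : 0 < ε₁) (hε₁1 : ε₁ ≤ 1)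
    (hRQ : R ≤ Q₀) (hHl : N * Q₀ / R ^ 2 ≤ H₀) (hHu : (H₀ : ℝ) ≤ C₀ * N * Q₀ / R ^ 2)
    (hI : (𝓘₀.card : ℝ) ≤ C₀ * M * R ^ 2 / (N * (Q₀ : ℝ) ^ 2)) (hα : ‖α₀‖ ≤ 1)
    (hx : ∀ I ∈ 𝓘₀, ∀ k, |x₀ I k| ≤ bourgainXBound ((R / Q₀) ^ 2 * Real.sqrt H₀) k)
    (hS : s ≤ C₀ * (M * Real.log N / Real.sqrt N + R * Real.log N ^ 2 / Real.sqrt Q₀ *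
      ∑ I ∈ 𝓘₀, (‖bourgainHSum H₀ α₀ (x₀ I)‖ + (Q₀ : ℝ) / R)))
    (hs0 : 0 ≤ s) (hcase : (Q₀ : ℝ) < R ^ (2 / 3 : ℝ) * N ^ (1 / 3 : ℝ))
    (hCA : ∀ H : ℕ, 1 ≤ H → ∀ X₃ : ℝ, (H : ℝ) ^ (-(1 / 2 : ℝ)) ≤ X₃ →
      X₃ ≤ (H : ℝ) ^ (1 / 2 : ℝ) → ∀ V : ℝ, 1 ≤ V → ∀ (𝓘 : Finset ℕ) (x : ℕ → Fin 4 → ℝ),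
        (∀ I ∈ 𝓘, ∀ k, |x I k| ≤ bourgainXBound X₃ k) → ∀ α : ℂ, ‖α‖ ≤ 1 →
          ∑ I ∈ 𝓘, ‖bourgainHSum H α (x I)‖ ^ 6 ≤
            CA * (H : ℝ) ^ (6 + ε₁) * Real.sqrt (V * bourgainSecondSpacingCount 𝓘 x H V)) :
    Params M N R Q₀ H₀ C₀ ε₁ ∧
    s ^ 6 ≤ 3 ^ 5 * (C₀ ^ 6 * (M ^ 6 * Real.log N ^ 6 / N ^ 3) +
      C₀ ^ 12 * (M ^ 6 * Real.log N ^ 12 * R ^ 3 / N ^ 6) +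
      C₀ ^ 6 * (R ^ 6 * Real.log N ^ 12 / (Q₀ : ℝ) ^ 3) *
        ((𝓘₀.card : ℝ) ^ 5 * ∑ I ∈ 𝓘₀, ‖bourgainHSum H₀ α₀ (x₀ I)‖ ^ 6)) ∧
    ∀ V : ℝ, 1 ≤ V → ∑ I ∈ 𝓘₀, ‖bourgainHSum H₀ α₀ (x₀ I)‖ ^ 6 ≤
      CA * (H₀ : ℝ) ^ (6 + ε₁) * Real.sqrt (V * bourgainSecondSpacingCount 𝓘₀ x₀ H₀ V) := by
  have hN0 : 0 < N := by linarith
  have hR0 : 0 < R := by linarith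
  have hQ0 : (0 : ℝ) < Q₀ := by linarith
  have hM : 0 < M := by linarith
  -- `Q ≤ N` in the regime (3.6)
  have hQN : (Q₀ : ℝ) ≤ N := by
    have h1 : R ^ (2 / 3 : ℝ) * N ^ (1 / 3 : ℝ) ≤ N ^ (2 / 3 : ℝ) * N ^ (1 / 3 : ℝ) :=
      mul_le_mul_of_nonneg_right (Real.rpow_le_rpow hR0.le hRN (by norm_num)) (by positivity)
    rw [← Real.rpow_add hN0, show (2 / 3 + 1 / 3 : ℝ) = 1 by norm_num, Real.rpow_one] at h1
    linarith
  have hp : Params M N R Q₀ H₀ C₀ ε₁ := ⟨hR, hRQ, hQN, hRN, hM, hC₀, hHl, hHu, hε₁, hε₁1⟩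
  have hH0 : (0 : ℝ) < H₀ := hp.H_pos
  have hH1 : 1 ≤ H₀ := by
    rcases Nat.eq_zero_or_pos H₀ with h | h
    · subst h; simp at hH0
    · exact h
  -- the sum in (3.4)
  have hsum : ∑ I ∈ 𝓘₀, (‖bourgainHSum H₀ α₀ (x₀ I)‖ + (Q₀ : ℝ) / R) =
      (∑ I ∈ 𝓘₀, ‖bourgainHSum H₀ α₀ (x₀ I)‖) + (𝓘₀.card : ℝ) * ((Q₀ : ℝ) / R) := by
    rw [Finset.sum_add_distrib, Finset.sum_const, nsmul_eq_mul]
  rw [hsum] at hS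
  have hHolder : (∑ I ∈ 𝓘₀, ‖bourgainHSum H₀ α₀ (x₀ I)‖) ^ 6 ≤
      (𝓘₀.card : ℝ) ^ 5 * ∑ I ∈ 𝓘₀, ‖bourgainHSum H₀ α₀ (x₀ I)‖ ^ 6 :=
    pow_sum_le_card_mul_sum_pow (fun i _ => norm_nonneg _) 5
  have hsplit := caseB_split hN.le hR hRN hRQ hC₀ hM (Real.log_pos hN) hs0 (Nat.cast_nonneg _)
    hI (Finset.sum_nonneg fun _ _ => norm_nonneg _) hHolder hS
  refine ⟨hp, hsplit, fun V hV => ?_⟩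
  -- the box parameter `X₃ = (R/Q)² H^{1/2}` lies in `[H^{-1/2}, H^{1/2}]`
  have hsq : Real.sqrt (H₀ : ℝ) = (H₀ : ℝ) ^ (1 / 2 : ℝ) := Real.sqrt_eq_rpow _
  have hRQ1 : R / Q₀ ≤ 1 := (div_le_one hQ0).2 hRQ
  have hXu : (R / Q₀) ^ 2 * Real.sqrt H₀ ≤ (H₀ : ℝ) ^ (1 / 2 : ℝ) := by
    rw [hsq]
    calc (R / Q₀) ^ 2 * (H₀ : ℝ) ^ (1 / 2 : ℝ) ≤ 1 * (H₀ : ℝ) ^ (1 / 2 : ℝ) := by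
          gcongr
          exact pow_le_one₀ (by positivity) hRQ1
      _ = _ := one_mul _
  have hXl : (H₀ : ℝ) ^ (-(1 / 2 : ℝ)) ≤ (R / Q₀) ^ 2 * Real.sqrt H₀ := by
    have h1 : 1 ≤ (R / Q₀) ^ 2 * H₀ := by
      calc (1 : ℝ) ≤ N / Q₀ := (one_le_div hQ0).2 hQN
        _ = (R / Q₀) ^ 2 * (N * Q₀ / R ^ 2) := by field_simp
        _ ≤ (R / Q₀) ^ 2 * H₀ := by gcongr
    rw [Real.rpow_neg hH0.le, ← hsq, ← one_div, div_le_iff₀ (Real.sqrt_pos.2 hH0)]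
    calc (1 : ℝ) ≤ (R / Q₀) ^ 2 * H₀ := h1
      _ = (R / Q₀) ^ 2 * Real.sqrt H₀ * Real.sqrt H₀ := by
          rw [mul_assoc, Real.mul_self_sqrt hH0.le]
  exact hCA H₀ hH1 _ hXl hXu V hV 𝓘₀ x₀ hx α₀ hα

/-- `1 ≤ R` from `1 < N ≤ R²`, `R ≥ 0`. [folklore] -/
theorem one_le_of_sq_ge {R N : ℝ} (hR : 0 ≤ R) (hN : 1 < N) (hNR : N ≤ R ^ 2) : 1 ≤ R := by
  by_contra h
  rw [not_le] at h
  nlinarith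

/-- The regime comparisons for (3.12): `1/N³ ≤ 1/(N²R)` and `R³/N⁶ ≤ 1/(N²R)` for
`1 ≤ R ≤ N`, in the weighted forms used below. [folklore] -/
theorem aux312 {M N R X : ℝ} (hR : 1 ≤ R) (hRN : R ≤ N) (hM : 0 < M) (hX : 0 ≤ X) :
    M ^ 6 * X / N ^ 3 ≤ X * (M ^ 6 / (N ^ 2 * R)) ∧
    M ^ 6 * X * R ^ 3 / N ^ 6 ≤ X * (M ^ 6 / (N ^ 2 * R)) := by
  have hR0 : 0 < R := by linarith
  have hN0 : 0 < N := by linarith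
  constructor
  · rw [show M ^ 6 * X / N ^ 3 = X * (M ^ 6 / (N ^ 2 * N)) by ring]
    gcongr
  · have h4 : R ^ 4 ≤ N ^ 4 := pow_le_pow_left₀ hR0.le hRN 4
    rw [div_le_iff₀ (by positivity)]
    calc M ^ 6 * X * R ^ 3 = X * M ^ 6 * R ^ 4 / R := by field_simp
      _ ≤ X * M ^ 6 * N ^ 4 / R := by gcongr
      _ = X * (M ^ 6 / (N ^ 2 * R)) * N ^ 6 := by field_simp

/-- The regime comparisons for (3.16): `1/N³ ≤ N⁻³(N/R)^{2/3}` and `R³/N⁶ ≤ N⁻³(N/R)^{2/3}` for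
`1 ≤ R ≤ N`. [folklore] -/
theorem aux316 {M N R X : ℝ} (hR : 1 ≤ R) (hRN : R ≤ N) (hM : 0 < M) (hX : 0 ≤ X) :
    M ^ 6 * X / N ^ 3 ≤ X * (M ^ 6 / N ^ 3 * (N / R) ^ (2 / 3 : ℝ)) ∧
    M ^ 6 * X * R ^ 3 / N ^ 6 ≤ X * (M ^ 6 / N ^ 3 * (N / R) ^ (2 / 3 : ℝ)) := by
  have hR0 : 0 < R := by linarith
  have hN0 : 0 < N := by linarith
  have hNR : 1 ≤ N / R := (one_le_div hR0).2 hRN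
  have h1 : 1 ≤ (N / R) ^ (2 / 3 : ℝ) := Real.one_le_rpow hNR (by norm_num)
  constructor
  · calc M ^ 6 * X / N ^ 3 = X * (M ^ 6 / N ^ 3 * 1) := by ring
      _ ≤ X * (M ^ 6 / N ^ 3 * (N / R) ^ (2 / 3 : ℝ)) := by gcongr
  · rcases eq_or_lt_of_le hX with h | h
    · rw [← h]; simp
    apply le_of_log_le_log (by positivity) (by positivity)
    have lRN := Real.log_le_log hR0 hRN
    simp (disch := positivity) only [Real.log_mul, Real.log_div, Real.log_pow, Real.log_rpow,
      Nat.cast_ofNat]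
    nlinarith

/-- `min` selection for (3.16): if `N³ ≤ R⁵` then `M^{11/2}NR^{-7/2} ≤ M^{11/2}R⁻¹N^{-1/2}`, and if
`R⁵ ≤ N³` the reverse inequality. [folklore] -/
theorem aux316_min {M N R : ℝ} (hR : 0 < R) (hN : 0 < N) (hM : 0 < M) :
    (N ^ 3 ≤ R ^ 5 → M ^ (11 / 2 : ℝ) * N / R ^ (7 / 2 : ℝ) ≤ M ^ (11 / 2 : ℝ) / (R * N ^ (1 / 2 : ℝ))) ∧
    (R ^ 5 ≤ N ^ 3 → M ^ (11 / 2 : ℝ) / (R * N ^ (1 / 2 : ℝ)) ≤ M ^ (11 / 2 : ℝ) * N / R ^ (7 / 2 : ℝ)) := by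
  constructor
  · intro h
    apply le_of_log_le_log (by positivity) (by positivity)
    have l := Real.log_le_log (by positivity) h
    simp (disch := positivity) only [Real.log_mul, Real.log_div, Real.log_pow, Real.log_rpow,
      Nat.cast_ofNat] at l ⊢
    nlinarith
  · intro h
    apply le_of_log_le_log (by positivity) (by positivity)
    have l := Real.log_le_log (by positivity) h
    simp (disch := positivity) only [Real.log_mul, Real.log_div, Real.log_pow, Real.log_rpow,
      Nat.cast_ofNat] at l ⊢
    nlinarith

end BourgainTheorem4

/-! ## (3.12) and (3.16) from the reduction, and Theorem 4 -/

/-- **Bourgain 2017, (3.12) for `F = log`, from the Huxley–Watt reduction (3.4), the second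
spacing bound (3.11) and Corollary 3.** In the form consumed by
`Literature.NumberTheory.LFunctions.Bourgain2017_eq313_log_of_eq312`: for every `ε > 0` there
are `C, T₀` with `|S|⁶ ≤ C (M^{6+ε}/N³)(N/R)` whenever `T ≥ T₀`, `M ≤ √T`, `N = MT^{-2/7}`,
`1 < N < M`, `R ≤ N ≤ R²` (`R = bourgainR c M N T`, (3.3)). Hypotheses: `h34` = (3.4) with
its printed constraints, on explicit data `Q H α 𝓘 x` (functions of `(T, M, N)`); `h311` =
Huxley–Watt's "`B₁ ≪ Δ₁Δ₂(M/N)²(Q/R)⁴` if `N = MT^{-2/7}`, where `Δ₁ = 1/(3H²)`,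
`Δ₂ = Q²/(6R²H²)`" (the display before (3.11)), asked in the regime (3.6) only; `hC3` =
Corollary 3 (2.28) written out. See the module docstring for the argument.
[cite: BourgainJAMS2017, §4 eqs. (3.4)–(3.12)] -/
theorem Bourgain2017_eq312_log_of_reduction (c : ℝ)
    (Q H : ℝ → ℝ → ℝ → ℕ) (α : ℝ → ℝ → ℝ → ℂ) (𝓘 : ℝ → ℝ → ℝ → Finset ℕ)
    (x : ℝ → ℝ → ℝ → ℕ → Fin 4 → ℝ)
    (h34 : ∃ C₀ T₀ : ℝ, ∀ T M N : ℝ, T₀ ≤ T → M ≤ Real.sqrt T → 1 < N → N < M →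
      (bourgainR c M N T : ℝ) ≤ N → N ≤ (bourgainR c M N T : ℝ) ^ 2 →
        (bourgainR c M N T : ℝ) ≤ Q T M N ∧
        N * Q T M N / (bourgainR c M N T : ℝ) ^ 2 ≤ H T M N ∧
        (H T M N : ℝ) ≤ C₀ * N * Q T M N / (bourgainR c M N T : ℝ) ^ 2 ∧
        ((𝓘 T M N).card : ℝ) ≤ C₀ * M * (bourgainR c M N T : ℝ) ^ 2 / (N * (Q T M N : ℝ) ^ 2) ∧
        ‖α T M N‖ ≤ 1 ∧
        (∀ I ∈ 𝓘 T M N, ∀ k, |x T M N I k| ≤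
          bourgainXBound (((bourgainR c M N T : ℝ) / Q T M N) ^ 2 * Real.sqrt (H T M N)) k) ∧
        ‖bourgainSum Real.log T M‖ ≤ C₀ * (M * Real.log N / Real.sqrt N +
          (bourgainR c M N T : ℝ) * Real.log N ^ 2 / Real.sqrt (Q T M N) *
            ∑ I ∈ 𝓘 T M N, (‖bourgainHSum (H T M N) (α T M N) (x T M N I)‖ +
              (Q T M N : ℝ) / (bourgainR c M N T : ℝ))))
    (h311 : ∃ C₁ T₁ : ℝ, ∀ T M N : ℝ, T₁ ≤ T → M ≤ Real.sqrt T →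
      N = M * T ^ (-(2 / 7) : ℝ) → 1 < N → N < M →
      (bourgainR c M N T : ℝ) ≤ N → N ≤ (bourgainR c M N T : ℝ) ^ 2 →
      (Q T M N : ℝ) < (bourgainR c M N T : ℝ) ^ (2 / 3 : ℝ) * N ^ (1 / 3 : ℝ) →
        (bourgainSecondSpacingCount (𝓘 T M N) (x T M N) (H T M N) 1 : ℝ) ≤
          C₁ * (1 / (3 * (H T M N : ℝ) ^ 2)) *
            ((Q T M N : ℝ) ^ 2 / (6 * (bourgainR c M N T : ℝ) ^ 2 * (H T M N : ℝ) ^ 2)) *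
            (M / N) ^ 2 * ((Q T M N : ℝ) / (bourgainR c M N T : ℝ)) ^ 4)
    (hC3 : ∀ ε : ℝ, 0 < ε → ∃ C : ℝ, ∀ N : ℕ, 1 ≤ N → ∀ δ Δ : ℝ,
      1 / (N : ℝ) ^ 2 ≤ δ → δ ≤ 1 → 1 / (N : ℝ) ≤ Δ → Δ ≤ 1 →
        bourgainA6 N δ Δ ≤ C * δ * Δ * (N : ℝ) ^ (9 + ε)) :
    ∀ ε : ℝ, 0 < ε → ∃ C T₀ : ℝ, ∀ T M N : ℝ, T₀ ≤ T → M ≤ Real.sqrt T →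
      N = M * T ^ (-(2 / 7) : ℝ) → 1 < N → N < M →
      (bourgainR c M N T : ℝ) ≤ N → N ≤ (bourgainR c M N T : ℝ) ^ 2 →
        ‖bourgainSum Real.log T M‖ ^ 6 ≤
          C * (M ^ (6 + ε) / N ^ 3 * (N / (bourgainR c M N T : ℝ))) := by
  intro ε hε
  obtain ⟨C₀, T₀, h34⟩ := h34
  obtain ⟨C₁, T₁, h311⟩ := h311
  -- the auxiliary exponent `ε₁ = min(ε/4, 1)`
  set ε₁ : ℝ := min (ε / 4) 1 with hε₁def
  have hε₁ : 0 < ε₁ := lt_min (by linarith) one_pos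
  have hε₁1 : ε₁ ≤ 1 := min_le_right _ _
  have h4 : 4 * ε₁ ≤ ε := by have := min_le_left (ε / 4) 1; linarith
  obtain ⟨CA, hCA⟩ := Bourgain2017_sixthMoment_of_corollary3 hC3 hε₁
  -- constants `≥ 1`
  set C₀' : ℝ := max C₀ 1 with hC₀'def
  set CA' : ℝ := max CA 1 with hCA'def
  set C₁' : ℝ := max C₁ 1 with hC₁'def
  have hC₀' : 1 ≤ C₀' := le_max_right _ _
  have hCA' : 1 ≤ CA' := le_max_right _ _
  have hC₁' : 1 ≤ C₁' := le_max_right _ _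
  have hCA'' : ∀ H : ℕ, 1 ≤ H → ∀ X₃ : ℝ, (H : ℝ) ^ (-(1 / 2 : ℝ)) ≤ X₃ →
      X₃ ≤ (H : ℝ) ^ (1 / 2 : ℝ) → ∀ V : ℝ, 1 ≤ V → ∀ (𝓘 : Finset ℕ) (x : ℕ → Fin 4 → ℝ),
        (∀ I ∈ 𝓘, ∀ k, |x I k| ≤ bourgainXBound X₃ k) → ∀ α : ℂ, ‖α‖ ≤ 1 →
          ∑ I ∈ 𝓘, ‖bourgainHSum H α (x I)‖ ^ 6 ≤
            CA' * (H : ℝ) ^ (6 + ε₁) * Real.sqrt (V * bourgainSecondSpacingCount 𝓘 x H V) :=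
    fun H hH X₃ h1 h2 V hV 𝓘 x hx α hα =>
      (hCA H hH X₃ h1 h2 V hV 𝓘 x hx α hα).trans (by gcongr; exact le_max_left _ _)
  -- the constant
  set K : ℝ := 3 ^ 6 * 2 ^ 5 * C₀' ^ 18 * ((6 / ε) ^ 6 + (12 / ε) ^ 12) +
    3 ^ 5 * (C₀' ^ 6 * (6 / ε) ^ 6 + C₀' ^ 12 * (12 / ε) ^ 12 +
      C₀' ^ 16 * CA' * C₁' * (24 / ε) ^ 12) with hK
  have hK1 : 3 ^ 6 * 2 ^ 5 * C₀' ^ 18 * ((6 / ε) ^ 6 + (12 / ε) ^ 12) ≤ K := by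
    rw [hK]; exact le_add_of_nonneg_right (by positivity)
  have hK2 : 3 ^ 5 * (C₀' ^ 6 * (6 / ε) ^ 6 + C₀' ^ 12 * (12 / ε) ^ 12 +
      C₀' ^ 16 * CA' * C₁' * (24 / ε) ^ 12) ≤ K := by
    rw [hK]; exact le_add_of_nonneg_left (by positivity)
  refine ⟨K, max T₀ T₁, ?_⟩
  intro T M N hT hMT hNdef hN1 hNM hRN hNR
  have hT₀ : T₀ ≤ T := (le_max_left _ _).trans hT
  have hT₁ : T₁ ≤ T := (le_max_right _ _).trans hT
  obtain ⟨hRQ, hHl, hHu, hI, hα, hx, hS⟩ := h34 T M N hT₀ hMT hN1 hNM hRN hNR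
  have h311' := h311 T M N hT₁ hMT hNdef hN1 hNM hRN hNR
  set R : ℝ := (bourgainR c M N T : ℝ) with hRdef
  have hN0 : 0 < N := by linarith
  have hM0 : 0 < M := by linarith
  have hR1 : 1 ≤ R := BourgainTheorem4.one_le_of_sq_ge (Nat.cast_nonneg _) hN1 hNR
  have hR0 : 0 < R := by linarith
  have hQ0 : (0 : ℝ) < Q T M N := by linarith
  have hL := Real.log_pos hN1
  -- upgrade the constant `C₀` to `C₀' ≥ 1`
  have hHu' : (H T M N : ℝ) ≤ C₀' * N * Q T M N / R ^ 2 :=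
    hHu.trans (by gcongr; exact le_max_left _ _)
  have hI' : ((𝓘 T M N).card : ℝ) ≤ C₀' * M * R ^ 2 / (N * (Q T M N : ℝ) ^ 2) :=
    hI.trans (by gcongr; exact le_max_left _ _)
  have hS' : ‖bourgainSum Real.log T M‖ ≤ C₀' * (M * Real.log N / Real.sqrt N +
      R * Real.log N ^ 2 / Real.sqrt (Q T M N) *
        ∑ I ∈ 𝓘 T M N, (‖bourgainHSum (H T M N) (α T M N) (x T M N I)‖ +
          (Q T M N : ℝ) / R)) :=
    hS.trans (mul_le_mul_of_nonneg_right (le_max_left _ _) (by positivity))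
  obtain ⟨hL6, hL12, hL12N⟩ := BourgainTheorem4.log_absorb hN1 hNM.le hε h4
  -- the target monomial
  set Y : ℝ := M ^ ε * (M ^ 6 / (N ^ 2 * R)) with hYdef
  have hY0 : 0 ≤ Y := by positivity
  have htarget : M ^ (6 + ε) / N ^ 3 * (N / R) = Y := by
    rw [hYdef, Real.rpow_add hM0, show (6 : ℝ) = ((6 : ℕ) : ℝ) by norm_num, Real.rpow_natCast]
    field_simp
  rw [htarget]
  have hMε : 0 ≤ M ^ ε := by positivity
  by_cases hcase : (Q T M N : ℝ) < R ^ (2 / 3 : ℝ) * N ^ (1 / 3 : ℝ)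
  · -- the regime (3.6)
    obtain ⟨hp, hsplit, hS₆⟩ := BourgainTheorem4.caseB_pointwise hN1 hNM hR1 hRN hC₀' hε₁ hε₁1
      hRQ hHl hHu' hI' hα hx hS' (norm_nonneg _) hcase hCA''
    have hS₆1 := hS₆ 1 le_rfl
    rw [one_mul] at hS₆1
    have hB := (h311' hcase).trans
      (show C₁ * (1 / (3 * (H T M N : ℝ) ^ 2)) *
          ((Q T M N : ℝ) ^ 2 / (6 * R ^ 2 * (H T M N : ℝ) ^ 2)) * (M / N) ^ 2 *
          ((Q T M N : ℝ) / R) ^ 4 ≤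
        C₁' * (1 / (3 * (H T M N : ℝ) ^ 2)) *
          ((Q T M N : ℝ) ^ 2 / (6 * R ^ 2 * (H T M N : ℝ) ^ 2)) * (M / N) ^ 2 *
          ((Q T M N : ℝ) / R) ^ 4 by gcongr; exact le_max_left _ _)
    have hw := BourgainTheorem4.caseB_w312 hp hCA' hC₁' hL (Nat.cast_nonneg _) hI'
      (Finset.sum_nonneg fun _ _ => by positivity) hS₆1 hB
    have hA : M ^ 6 * Real.log N ^ 6 / N ^ 3 ≤ (6 / ε) ^ 6 * Y := by
      calc M ^ 6 * Real.log N ^ 6 / N ^ 3 ≤ M ^ 6 * ((6 / ε) ^ 6 * M ^ ε) / N ^ 3 := by gcongr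
        _ ≤ ((6 / ε) ^ 6 * M ^ ε) * (M ^ 6 / (N ^ 2 * R)) :=
            (BourgainTheorem4.aux312 hR1 hRN hM0 (by positivity)).1
        _ = (6 / ε) ^ 6 * Y := by rw [hYdef]; ring
    have hBB : M ^ 6 * Real.log N ^ 12 * R ^ 3 / N ^ 6 ≤ (12 / ε) ^ 12 * Y := by
      calc M ^ 6 * Real.log N ^ 12 * R ^ 3 / N ^ 6
          ≤ M ^ 6 * ((12 / ε) ^ 12 * M ^ ε) * R ^ 3 / N ^ 6 := by gcongr
        _ ≤ ((12 / ε) ^ 12 * M ^ ε) * (M ^ 6 / (N ^ 2 * R)) :=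
            (BourgainTheorem4.aux312 hR1 hRN hM0 (by positivity)).2
        _ = (12 / ε) ^ 12 * Y := by rw [hYdef]; ring
    have hC : C₀' ^ 6 * (R ^ 6 * Real.log N ^ 12 / (Q T M N : ℝ) ^ 3) *
        (((𝓘 T M N).card : ℝ) ^ 5 *
          ∑ I ∈ 𝓘 T M N, ‖bourgainHSum (H T M N) (α T M N) (x T M N I)‖ ^ 6) ≤
        C₀' ^ 16 * CA' * C₁' * ((24 / ε) ^ 12 * Y) := by
      refine hw.trans ?_
      have h1 : Real.log N ^ 12 * N ^ (2 * ε₁) * (M ^ 6 / (N ^ 2 * R)) ≤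
          (24 / ε) ^ 12 * M ^ ε * (M ^ 6 / (N ^ 2 * R)) :=
        mul_le_mul_of_nonneg_right hL12N (by positivity)
      calc C₀' ^ 16 * CA' * C₁' * (Real.log N ^ 12 * N ^ (2 * ε₁) * (M ^ 6 / (N ^ 2 * R)))
          ≤ C₀' ^ 16 * CA' * C₁' * ((24 / ε) ^ 12 * M ^ ε * (M ^ 6 / (N ^ 2 * R))) := by gcongr
        _ = C₀' ^ 16 * CA' * C₁' * ((24 / ε) ^ 12 * Y) := by rw [hYdef]; ring
    calc ‖bourgainSum Real.log T M‖ ^ 6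
        ≤ 3 ^ 5 * (C₀' ^ 6 * (M ^ 6 * Real.log N ^ 6 / N ^ 3) +
            C₀' ^ 12 * (M ^ 6 * Real.log N ^ 12 * R ^ 3 / N ^ 6) +
            C₀' ^ 6 * (R ^ 6 * Real.log N ^ 12 / (Q T M N : ℝ) ^ 3) *
              (((𝓘 T M N).card : ℝ) ^ 5 *
                ∑ I ∈ 𝓘 T M N, ‖bourgainHSum (H T M N) (α T M N) (x T M N I)‖ ^ 6)) := hsplit
      _ ≤ 3 ^ 5 * (C₀' ^ 6 * ((6 / ε) ^ 6 * Y) + C₀' ^ 12 * ((12 / ε) ^ 12 * Y) +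
            C₀' ^ 16 * CA' * C₁' * ((24 / ε) ^ 12 * Y)) := by
          gcongr 3 ^ 5 * (C₀' ^ 6 * ?_ + C₀' ^ 12 * ?_ + ?_)
      _ = 3 ^ 5 * (C₀' ^ 6 * (6 / ε) ^ 6 + C₀' ^ 12 * (12 / ε) ^ 12 +
            C₀' ^ 16 * CA' * C₁' * (24 / ε) ^ 12) * Y := by ring
      _ ≤ K * Y := mul_le_mul_of_nonneg_right hK2 hY0
  · -- the regime `Q ≥ R^{2/3} N^{1/3}`: the trivial bound (3.5)
    rw [not_lt] at hcase
    rw [Finset.sum_add_distrib, Finset.sum_const, nsmul_eq_mul] at hS'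
    have hS₁H : ∑ I ∈ 𝓘 T M N, ‖bourgainHSum (H T M N) (α T M N) (x T M N I)‖ ≤
        ((𝓘 T M N).card : ℝ) * (H T M N : ℝ) := by
      calc ∑ I ∈ 𝓘 T M N, ‖bourgainHSum (H T M N) (α T M N) (x T M N I)‖
          ≤ ∑ _I ∈ 𝓘 T M N, (H T M N : ℝ) :=
            Finset.sum_le_sum fun I _ => BourgainTheorem4.norm_bourgainHSum_le _ hα _
        _ = ((𝓘 T M N).card : ℝ) * (H T M N : ℝ) := by
            rw [Finset.sum_const, nsmul_eq_mul]
    have hAb := BourgainTheorem4.caseA_bound hN1.le hR1 hRN hRQ hC₀' hM0 hL (Nat.cast_nonneg _)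
      hHu' hI' hS₁H hS' hcase
    have h6 := BourgainTheorem4.caseA_pow_six hN0 hM0 hL hC₀' (norm_nonneg _) hAb
    have hLL : Real.log N ^ 6 + Real.log N ^ 12 ≤ ((6 / ε) ^ 6 + (12 / ε) ^ 12) * M ^ ε := by
      rw [add_mul]; exact add_le_add hL6 hL12
    calc ‖bourgainSum Real.log T M‖ ^ 6
        ≤ 3 ^ 6 * 2 ^ 5 * C₀' ^ 18 * (M ^ 6 * (Real.log N ^ 6 + Real.log N ^ 12) / N ^ 3) := h6
      _ ≤ 3 ^ 6 * 2 ^ 5 * C₀' ^ 18 * (M ^ 6 * (((6 / ε) ^ 6 + (12 / ε) ^ 12) * M ^ ε) / N ^ 3) := by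
          gcongr
      _ ≤ 3 ^ 6 * 2 ^ 5 * C₀' ^ 18 * ((((6 / ε) ^ 6 + (12 / ε) ^ 12) * M ^ ε) *
            (M ^ 6 / (N ^ 2 * R))) := by
          gcongr
          exact (BourgainTheorem4.aux312 hR1 hRN hM0 (by positivity)).1
      _ = 3 ^ 6 * 2 ^ 5 * C₀' ^ 18 * ((6 / ε) ^ 6 + (12 / ε) ^ 12) * Y := by rw [hYdef]; ring
      _ ≤ K * Y := mul_le_mul_of_nonneg_right hK1 hY0

/-- **Bourgain 2017, (3.16) for `F = log`, from the Huxley–Watt reduction (3.4), Huxley's second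
spacing bound (3.15) and Corollary 3.** In the form consumed by
`Literature.NumberTheory.LFunctions.Bourgain2017_eq318_log_of_eq316`: for every `ε > 0` there are
`C, T₀` with
`|S|⁶ ≤ C M^ε (min{M^{11/2}NR^{-7/2}, M^{11/2}R⁻¹N^{-1/2}} + (M⁶/N³)(N/R)^{2/3})` whenever `T ≥ T₀`,
`M ≤ √T`, `1 < N < M`, `R ≤ N ≤ R²`. Hypotheses: `h34` = (3.4) with its printed constraints, on
explicit data `Q H α 𝓘 x`; `h315` = Huxley's (3.15) "if `M ≤ √T`, and if one has either
`V = N/Q ≪ R⁴/N²`, or else `V = R⁴/N²` …, then `VB_V ≪ (VMR²/(NQ²) + Δ₁Δ₂Δ₄^{2/3}(M/N)²)(Q/R)⁴`"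
(`Δ₁ = 1/(3H²)`, `Δ₂ = Q²/(6R²H²)`, `Δ₄ = Q²/(6R²H)`), asked in the regime (3.6) only and with the
side condition `N/Q ≤ R⁴/N²` for the first choice; `hC3` = Corollary 3 (2.28). The choice is
`V = N/Q` if `N³ ≤ R⁵` and `V = R⁴/N²` otherwise (p. 12). See the module docstring.
[cite: BourgainJAMS2017, §4 eqs. (3.4)–(3.10), (3.14)–(3.16)] -/
theorem Bourgain2017_eq316_log_of_reduction (c : ℝ)
    (Q H : ℝ → ℝ → ℝ → ℕ) (α : ℝ → ℝ → ℝ → ℂ) (𝓘 : ℝ → ℝ → ℝ → Finset ℕ)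
    (x : ℝ → ℝ → ℝ → ℕ → Fin 4 → ℝ)
    (h34 : ∃ C₀ T₀ : ℝ, ∀ T M N : ℝ, T₀ ≤ T → M ≤ Real.sqrt T → 1 < N → N < M →
      (bourgainR c M N T : ℝ) ≤ N → N ≤ (bourgainR c M N T : ℝ) ^ 2 →
        (bourgainR c M N T : ℝ) ≤ Q T M N ∧
        N * Q T M N / (bourgainR c M N T : ℝ) ^ 2 ≤ H T M N ∧
        (H T M N : ℝ) ≤ C₀ * N * Q T M N / (bourgainR c M N T : ℝ) ^ 2 ∧
        ((𝓘 T M N).card : ℝ) ≤ C₀ * M * (bourgainR c M N T : ℝ) ^ 2 / (N * (Q T M N : ℝ) ^ 2) ∧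
        ‖α T M N‖ ≤ 1 ∧
        (∀ I ∈ 𝓘 T M N, ∀ k, |x T M N I k| ≤
          bourgainXBound (((bourgainR c M N T : ℝ) / Q T M N) ^ 2 * Real.sqrt (H T M N)) k) ∧
        ‖bourgainSum Real.log T M‖ ≤ C₀ * (M * Real.log N / Real.sqrt N +
          (bourgainR c M N T : ℝ) * Real.log N ^ 2 / Real.sqrt (Q T M N) *
            ∑ I ∈ 𝓘 T M N, (‖bourgainHSum (H T M N) (α T M N) (x T M N I)‖ +
              (Q T M N : ℝ) / (bourgainR c M N T : ℝ))))
    (h315 : ∃ C₂ T₂ : ℝ, ∀ T M N : ℝ, T₂ ≤ T → M ≤ Real.sqrt T → 1 < N → N < M →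
      (bourgainR c M N T : ℝ) ≤ N → N ≤ (bourgainR c M N T : ℝ) ^ 2 →
      (Q T M N : ℝ) < (bourgainR c M N T : ℝ) ^ (2 / 3 : ℝ) * N ^ (1 / 3 : ℝ) →
      ∀ V : ℝ, (V = N / Q T M N ∧ N / Q T M N ≤ (bourgainR c M N T : ℝ) ^ 4 / N ^ 2) ∨
          V = (bourgainR c M N T : ℝ) ^ 4 / N ^ 2 →
        V * (bourgainSecondSpacingCount (𝓘 T M N) (x T M N) (H T M N) V : ℝ) ≤
          C₂ * (V * M * (bourgainR c M N T : ℝ) ^ 2 / (N * (Q T M N : ℝ) ^ 2) +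
            (1 / (3 * (H T M N : ℝ) ^ 2)) *
              ((Q T M N : ℝ) ^ 2 / (6 * (bourgainR c M N T : ℝ) ^ 2 * (H T M N : ℝ) ^ 2)) *
              ((Q T M N : ℝ) ^ 2 / (6 * (bourgainR c M N T : ℝ) ^ 2 * (H T M N : ℝ))) ^
                (2 / 3 : ℝ) * (M / N) ^ 2) *
            ((Q T M N : ℝ) / (bourgainR c M N T : ℝ)) ^ 4)
    (hC3 : ∀ ε : ℝ, 0 < ε → ∃ C : ℝ, ∀ N : ℕ, 1 ≤ N → ∀ δ Δ : ℝ,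
      1 / (N : ℝ) ^ 2 ≤ δ → δ ≤ 1 → 1 / (N : ℝ) ≤ Δ → Δ ≤ 1 →
        bourgainA6 N δ Δ ≤ C * δ * Δ * (N : ℝ) ^ (9 + ε)) :
    ∀ ε : ℝ, 0 < ε → ∃ C T₀ : ℝ, ∀ T M N : ℝ, T₀ ≤ T → M ≤ Real.sqrt T →
      1 < N → N < M → (bourgainR c M N T : ℝ) ≤ N → N ≤ (bourgainR c M N T : ℝ) ^ 2 →
        ‖bourgainSum Real.log T M‖ ^ 6 ≤ C * M ^ ε *
          (min (M ^ (11 / 2 : ℝ) * N / (bourgainR c M N T : ℝ) ^ (7 / 2 : ℝ))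
              (M ^ (11 / 2 : ℝ) / ((bourgainR c M N T : ℝ) * N ^ (1 / 2 : ℝ))) +
            M ^ 6 / N ^ 3 * (N / (bourgainR c M N T : ℝ)) ^ (2 / 3 : ℝ)) := by
  intro ε hε
  obtain ⟨C₀, T₀, h34⟩ := h34
  obtain ⟨C₂, T₂, h315⟩ := h315
  set ε₁ : ℝ := min (ε / 4) 1 with hε₁def
  have hε₁ : 0 < ε₁ := lt_min (by linarith) one_pos
  have hε₁1 : ε₁ ≤ 1 := min_le_right _ _
  have h4 : 4 * ε₁ ≤ ε := by have := min_le_left (ε / 4) 1; linarith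
  obtain ⟨CA, hCA⟩ := Bourgain2017_sixthMoment_of_corollary3 hC3 hε₁
  set C₀' : ℝ := max C₀ 1 with hC₀'def
  set CA' : ℝ := max CA 1 with hCA'def
  set C₂' : ℝ := max C₂ 1 with hC₂'def
  have hC₀' : 1 ≤ C₀' := le_max_right _ _
  have hCA' : 1 ≤ CA' := le_max_right _ _
  have hC₂' : 1 ≤ C₂' := le_max_right _ _
  have hCA'' : ∀ H : ℕ, 1 ≤ H → ∀ X₃ : ℝ, (H : ℝ) ^ (-(1 / 2 : ℝ)) ≤ X₃ →
      X₃ ≤ (H : ℝ) ^ (1 / 2 : ℝ) → ∀ V : ℝ, 1 ≤ V → ∀ (𝓘 : Finset ℕ) (x : ℕ → Fin 4 → ℝ),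
        (∀ I ∈ 𝓘, ∀ k, |x I k| ≤ bourgainXBound X₃ k) → ∀ α : ℂ, ‖α‖ ≤ 1 →
          ∑ I ∈ 𝓘, ‖bourgainHSum H α (x I)‖ ^ 6 ≤
            CA' * (H : ℝ) ^ (6 + ε₁) * Real.sqrt (V * bourgainSecondSpacingCount 𝓘 x H V) :=
    fun H hH X₃ h1 h2 V hV 𝓘 x hx α hα =>
      (hCA H hH X₃ h1 h2 V hV 𝓘 x hx α hα).trans (by gcongr; exact le_max_left _ _)
  -- the constant
  set K : ℝ := 3 ^ 6 * 2 ^ 5 * C₀' ^ 18 * ((6 / ε) ^ 6 + (12 / ε) ^ 12) +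
    3 ^ 5 * (C₀' ^ 6 * (6 / ε) ^ 6 + C₀' ^ 12 * (12 / ε) ^ 12 +
      C₀' ^ 18 * CA' * C₂' * (24 / ε) ^ 12) with hK
  have hK1 : 3 ^ 6 * 2 ^ 5 * C₀' ^ 18 * ((6 / ε) ^ 6 + (12 / ε) ^ 12) ≤ K := by
    rw [hK]; exact le_add_of_nonneg_right (by positivity)
  have hK2 : 3 ^ 5 * (C₀' ^ 6 * (6 / ε) ^ 6 + C₀' ^ 12 * (12 / ε) ^ 12 +
      C₀' ^ 18 * CA' * C₂' * (24 / ε) ^ 12) ≤ K := by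
    rw [hK]; exact le_add_of_nonneg_left (by positivity)
  refine ⟨K, max T₀ T₂, ?_⟩
  intro T M N hT hMT hN1 hNM hRN hNR
  have hT₀ : T₀ ≤ T := (le_max_left _ _).trans hT
  have hT₂ : T₂ ≤ T := (le_max_right _ _).trans hT
  obtain ⟨hRQ, hHl, hHu, hI, hα, hx, hS⟩ := h34 T M N hT₀ hMT hN1 hNM hRN hNR
  have h315' := h315 T M N hT₂ hMT hN1 hNM hRN hNR
  set R : ℝ := (bourgainR c M N T : ℝ) with hRdef
  have hN0 : 0 < N := by linarith
  have hM0 : 0 < M := by linarith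
  have hR1 : 1 ≤ R := BourgainTheorem4.one_le_of_sq_ge (Nat.cast_nonneg _) hN1 hNR
  have hR0 : 0 < R := by linarith
  have hQ0 : (0 : ℝ) < Q T M N := by linarith
  have hL := Real.log_pos hN1
  have hHu' : (H T M N : ℝ) ≤ C₀' * N * Q T M N / R ^ 2 :=
    hHu.trans (by gcongr; exact le_max_left _ _)
  have hI' : ((𝓘 T M N).card : ℝ) ≤ C₀' * M * R ^ 2 / (N * (Q T M N : ℝ) ^ 2) :=
    hI.trans (by gcongr; exact le_max_left _ _)
  have hS' : ‖bourgainSum Real.log T M‖ ≤ C₀' * (M * Real.log N / Real.sqrt N +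
      R * Real.log N ^ 2 / Real.sqrt (Q T M N) *
        ∑ I ∈ 𝓘 T M N, (‖bourgainHSum (H T M N) (α T M N) (x T M N I)‖ +
          (Q T M N : ℝ) / R)) :=
    hS.trans (mul_le_mul_of_nonneg_right (le_max_left _ _) (by positivity))
  obtain ⟨hL6, hL12, hL12N⟩ := BourgainTheorem4.log_absorb hN1 hNM.le hε h4
  -- the target monomials
  set Z : ℝ := M ^ 6 / N ^ 3 * (N / R) ^ (2 / 3 : ℝ) with hZdef
  set m₁ : ℝ := M ^ (11 / 2 : ℝ) * N / R ^ (7 / 2 : ℝ) with hm₁def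
  set m₂ : ℝ := M ^ (11 / 2 : ℝ) / (R * N ^ (1 / 2 : ℝ)) with hm₂def
  have hZ0 : 0 ≤ Z := by positivity
  have hm₁0 : 0 ≤ m₁ := by positivity
  have hm₂0 : 0 ≤ m₂ := by positivity
  have hμ0 : 0 ≤ min m₁ m₂ := le_min hm₁0 hm₂0
  have hMε : 0 ≤ M ^ ε := by positivity
  have hZμ : Z ≤ min m₁ m₂ + Z := le_add_of_nonneg_left hμ0
  by_cases hcase : (Q T M N : ℝ) < R ^ (2 / 3 : ℝ) * N ^ (1 / 3 : ℝ)
  · -- the regime (3.6)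
    obtain ⟨hp, hsplit, hS₆⟩ := BourgainTheorem4.caseB_pointwise hN1 hNM hR1 hRN hC₀' hε₁ hε₁1
      hRQ hHl hHu' hI' hα hx hS' (norm_nonneg _) hcase hCA''
    have hQN := hp.Q_le_N
    -- upgrade the constant `C₂` to `C₂' ≥ 1` in (3.15)
    have h315'' : ∀ V : ℝ, (V = N / Q T M N ∧ N / Q T M N ≤ R ^ 4 / N ^ 2) ∨ V = R ^ 4 / N ^ 2 →
        0 ≤ V →
        V * (bourgainSecondSpacingCount (𝓘 T M N) (x T M N) (H T M N) V : ℝ) ≤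
          C₂' * (V * M * R ^ 2 / (N * (Q T M N : ℝ) ^ 2) +
            (1 / (3 * (H T M N : ℝ) ^ 2)) *
              ((Q T M N : ℝ) ^ 2 / (6 * R ^ 2 * (H T M N : ℝ) ^ 2)) *
              ((Q T M N : ℝ) ^ 2 / (6 * R ^ 2 * (H T M N : ℝ))) ^ (2 / 3 : ℝ) * (M / N) ^ 2) *
            ((Q T M N : ℝ) / R) ^ 4 := fun V hV hV0 =>
      (h315' hcase V hV).trans (mul_le_mul_of_nonneg_right
        (mul_le_mul_of_nonneg_right (le_max_left _ _) (by positivity)) (by positivity))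
    -- the main term: `w⁶ ≤ C₀'¹⁸ CA' C₂' L¹² N^{2ε₁} (min + Z)`
    have hC : C₀' ^ 6 * (R ^ 6 * Real.log N ^ 12 / (Q T M N : ℝ) ^ 3) *
        (((𝓘 T M N).card : ℝ) ^ 5 *
          ∑ I ∈ 𝓘 T M N, ‖bourgainHSum (H T M N) (α T M N) (x T M N I)‖ ^ 6) ≤
        C₀' ^ 18 * CA' * C₂' * (Real.log N ^ 12 * N ^ (2 * ε₁)) * (min m₁ m₂ + Z) := by
      by_cases h5 : N ^ 3 ≤ R ^ 5
      · -- `V = N/Q`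
        have hV1 : 1 ≤ N / Q T M N := (one_le_div hQ0).2 hQN
        have hVadm : N / Q T M N ≤ R ^ 4 / N ^ 2 := by
          calc N / Q T M N ≤ N / R := div_le_div_of_nonneg_left hN0.le hR0 hRQ
            _ ≤ R ^ 4 / N ^ 2 := by
                rw [div_le_div_iff₀ hR0 (by positivity), show N * N ^ 2 = N ^ 3 by ring,
                  show R ^ 4 * R = R ^ 5 by ring]
                exact h5
        have hS₆V := hS₆ (N / Q T M N) hV1
        have hVB := h315'' (N / Q T M N) (Or.inl ⟨rfl, hVadm⟩) (by positivity)
        have hpre := BourgainTheorem4.caseB_w316_prefix hp hCA' hC₂' hL (by positivity)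
          (Nat.cast_nonneg _) hI' (Finset.sum_nonneg fun _ _ => by positivity) hS₆V hVB
        have hfirst := BourgainTheorem4.caseB_w316_first_i hp hCA' hC₂' hL
        have hdelta := BourgainTheorem4.caseB_w316_delta hp hCA' hC₂' hL
        have hm : m₁ ≤ min m₁ m₂ :=
          le_min le_rfl ((BourgainTheorem4.aux316_min hR0 hN0 hM0).1 h5)
        refine hpre.trans ?_
        rw [mul_add]
        calc _ ≤ C₀' ^ 18 * CA' * C₂' * (Real.log N ^ 12 * N ^ (2 * ε₁)) * m₁ +
              C₀' ^ 18 * CA' * C₂' * (Real.log N ^ 12 * N ^ (2 * ε₁)) * Z := add_le_add hfirst hdelta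
          _ ≤ C₀' ^ 18 * CA' * C₂' * (Real.log N ^ 12 * N ^ (2 * ε₁)) * min m₁ m₂ +
              C₀' ^ 18 * CA' * C₂' * (Real.log N ^ 12 * N ^ (2 * ε₁)) * Z := by gcongr
          _ = _ := by ring
      · -- `V = R⁴/N²`
        have h5' : R ^ 5 ≤ N ^ 3 := le_of_lt (not_le.1 h5)
        have hV1 : 1 ≤ R ^ 4 / N ^ 2 := by
          rw [one_le_div (by positivity)]
          calc N ^ 2 ≤ (R ^ 2) ^ 2 := pow_le_pow_left₀ hN0.le hNR 2
            _ = R ^ 4 := by ring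
        have hS₆V := hS₆ (R ^ 4 / N ^ 2) hV1
        have hVB := h315'' (R ^ 4 / N ^ 2) (Or.inr rfl) (by positivity)
        have hpre := BourgainTheorem4.caseB_w316_prefix hp hCA' hC₂' hL (by positivity)
          (Nat.cast_nonneg _) hI' (Finset.sum_nonneg fun _ _ => by positivity) hS₆V hVB
        have hfirst := BourgainTheorem4.caseB_w316_first_ii hp hCA' hC₂' hL
        have hdelta := BourgainTheorem4.caseB_w316_delta hp hCA' hC₂' hL
        have hm : m₂ ≤ min m₁ m₂ :=
          le_min ((BourgainTheorem4.aux316_min hR0 hN0 hM0).2 h5') le_rfl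
        refine hpre.trans ?_
        rw [mul_add]
        calc _ ≤ C₀' ^ 18 * CA' * C₂' * (Real.log N ^ 12 * N ^ (2 * ε₁)) * m₂ +
              C₀' ^ 18 * CA' * C₂' * (Real.log N ^ 12 * N ^ (2 * ε₁)) * Z := add_le_add hfirst hdelta
          _ ≤ C₀' ^ 18 * CA' * C₂' * (Real.log N ^ 12 * N ^ (2 * ε₁)) * min m₁ m₂ +
              C₀' ^ 18 * CA' * C₂' * (Real.log N ^ 12 * N ^ (2 * ε₁)) * Z := by gcongr
          _ = _ := by ring
    have hA : M ^ 6 * Real.log N ^ 6 / N ^ 3 ≤ (6 / ε) ^ 6 * M ^ ε * (min m₁ m₂ + Z) := by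
      calc M ^ 6 * Real.log N ^ 6 / N ^ 3 ≤ M ^ 6 * ((6 / ε) ^ 6 * M ^ ε) / N ^ 3 := by gcongr
        _ ≤ ((6 / ε) ^ 6 * M ^ ε) * Z := (BourgainTheorem4.aux316 hR1 hRN hM0 (by positivity)).1
        _ ≤ ((6 / ε) ^ 6 * M ^ ε) * (min m₁ m₂ + Z) := by gcongr
    have hBB : M ^ 6 * Real.log N ^ 12 * R ^ 3 / N ^ 6 ≤ (12 / ε) ^ 12 * M ^ ε * (min m₁ m₂ + Z) := by
      calc M ^ 6 * Real.log N ^ 12 * R ^ 3 / N ^ 6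
          ≤ M ^ 6 * ((12 / ε) ^ 12 * M ^ ε) * R ^ 3 / N ^ 6 := by gcongr
        _ ≤ ((12 / ε) ^ 12 * M ^ ε) * Z := (BourgainTheorem4.aux316 hR1 hRN hM0 (by positivity)).2
        _ ≤ ((12 / ε) ^ 12 * M ^ ε) * (min m₁ m₂ + Z) := by gcongr
    have hC' : C₀' ^ 6 * (R ^ 6 * Real.log N ^ 12 / (Q T M N : ℝ) ^ 3) *
        (((𝓘 T M N).card : ℝ) ^ 5 *
          ∑ I ∈ 𝓘 T M N, ‖bourgainHSum (H T M N) (α T M N) (x T M N I)‖ ^ 6) ≤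
        C₀' ^ 18 * CA' * C₂' * ((24 / ε) ^ 12 * M ^ ε) * (min m₁ m₂ + Z) := by
      refine hC.trans ?_
      gcongr
    calc ‖bourgainSum Real.log T M‖ ^ 6
        ≤ 3 ^ 5 * (C₀' ^ 6 * (M ^ 6 * Real.log N ^ 6 / N ^ 3) +
            C₀' ^ 12 * (M ^ 6 * Real.log N ^ 12 * R ^ 3 / N ^ 6) +
            C₀' ^ 6 * (R ^ 6 * Real.log N ^ 12 / (Q T M N : ℝ) ^ 3) *
              (((𝓘 T M N).card : ℝ) ^ 5 *
                ∑ I ∈ 𝓘 T M N, ‖bourgainHSum (H T M N) (α T M N) (x T M N I)‖ ^ 6)) := hsplit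
      _ ≤ 3 ^ 5 * (C₀' ^ 6 * ((6 / ε) ^ 6 * M ^ ε * (min m₁ m₂ + Z)) +
            C₀' ^ 12 * ((12 / ε) ^ 12 * M ^ ε * (min m₁ m₂ + Z)) +
            C₀' ^ 18 * CA' * C₂' * ((24 / ε) ^ 12 * M ^ ε) * (min m₁ m₂ + Z)) := by
          gcongr 3 ^ 5 * (C₀' ^ 6 * ?_ + C₀' ^ 12 * ?_ + ?_)
      _ = 3 ^ 5 * (C₀' ^ 6 * (6 / ε) ^ 6 + C₀' ^ 12 * (12 / ε) ^ 12 +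
            C₀' ^ 18 * CA' * C₂' * (24 / ε) ^ 12) * M ^ ε * (min m₁ m₂ + Z) := by ring
      _ ≤ K * M ^ ε * (min m₁ m₂ + Z) := by gcongr
  · -- the regime `Q ≥ R^{2/3} N^{1/3}`: the trivial bound (3.5)
    rw [not_lt] at hcase
    rw [Finset.sum_add_distrib, Finset.sum_const, nsmul_eq_mul] at hS'
    have hS₁H : ∑ I ∈ 𝓘 T M N, ‖bourgainHSum (H T M N) (α T M N) (x T M N I)‖ ≤
        ((𝓘 T M N).card : ℝ) * (H T M N : ℝ) := by
      calc ∑ I ∈ 𝓘 T M N, ‖bourgainHSum (H T M N) (α T M N) (x T M N I)‖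
          ≤ ∑ _I ∈ 𝓘 T M N, (H T M N : ℝ) :=
            Finset.sum_le_sum fun I _ => BourgainTheorem4.norm_bourgainHSum_le _ hα _
        _ = ((𝓘 T M N).card : ℝ) * (H T M N : ℝ) := by
            rw [Finset.sum_const, nsmul_eq_mul]
    have hAb := BourgainTheorem4.caseA_bound hN1.le hR1 hRN hRQ hC₀' hM0 hL (Nat.cast_nonneg _)
      hHu' hI' hS₁H hS' hcase
    have h6 := BourgainTheorem4.caseA_pow_six hN0 hM0 hL hC₀' (norm_nonneg _) hAb
    have hLL : Real.log N ^ 6 + Real.log N ^ 12 ≤ ((6 / ε) ^ 6 + (12 / ε) ^ 12) * M ^ ε := by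
      rw [add_mul]; exact add_le_add hL6 hL12
    calc ‖bourgainSum Real.log T M‖ ^ 6
        ≤ 3 ^ 6 * 2 ^ 5 * C₀' ^ 18 * (M ^ 6 * (Real.log N ^ 6 + Real.log N ^ 12) / N ^ 3) := h6
      _ ≤ 3 ^ 6 * 2 ^ 5 * C₀' ^ 18 * (M ^ 6 * (((6 / ε) ^ 6 + (12 / ε) ^ 12) * M ^ ε) / N ^ 3) := by
          gcongr
      _ ≤ 3 ^ 6 * 2 ^ 5 * C₀' ^ 18 * ((((6 / ε) ^ 6 + (12 / ε) ^ 12) * M ^ ε) * Z) := by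
          gcongr
          exact (BourgainTheorem4.aux316 hR1 hRN hM0 (by positivity)).1
      _ ≤ 3 ^ 6 * 2 ^ 5 * C₀' ^ 18 * ((((6 / ε) ^ 6 + (12 / ε) ^ 12) * M ^ ε) *
            (min m₁ m₂ + Z)) := by gcongr
      _ = 3 ^ 6 * 2 ^ 5 * C₀' ^ 18 * ((6 / ε) ^ 6 + (12 / ε) ^ 12) * M ^ ε * (min m₁ m₂ + Z) := by
          ring
      _ ≤ K * M ^ ε * (min m₁ m₂ + Z) := by gcongr

/-- **Bourgain 2017, Theorem 4 (for `F = log`) from the Bombieri–Iwaniec–Huxley–Watt inputs and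
Corollary 3.** `Literature.NumberTheory.LFunctions.Bourgain2017_theorem4_log`
(`|S| ≪ M^{1/2}T^{13/84+ε}` for `T^{17/42} ≤ M ≤ √T`) follows from: the Huxley–Watt reduction
(3.4) with its constraints (`h34`, on explicit data `Q H α 𝓘 x`, for one constant `c ∈ (0, 1]` in
(3.3)), Huxley–Watt's second spacing bound before (3.11) (`h311`), Huxley's (3.15) (`h315`), and
Corollary 3 (2.28) of the paper (`hC3`) — via (3.12) (`Bourgain2017_eq312_log_of_reduction`),
(3.16) (`Bourgain2017_eq316_log_of_reduction`), the optimisation in `N`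
(`Bourgain2017_theorem4_log_of_eq312_of_eq316`) and step 6
(`Bourgain2017_theorem4_log_of_eq313_of_eq318`). Everything else of §4 — the double large sieve
(3.8), the first spacing bound (3.10) from Corollary 3, (3.7), (3.12)–(3.14), (3.16)–(3.19) — is
proved in this tree. [cite: BourgainJAMS2017, Theorem 4, eq. (3.19); §4 eqs. (3.3)–(3.18)] -/
theorem Bourgain2017_theorem4_log_of_reduction {c : ℝ} (hc : 0 < c) (hc1 : c ≤ 1)
    (Q H : ℝ → ℝ → ℝ → ℕ) (α : ℝ → ℝ → ℝ → ℂ) (𝓘 : ℝ → ℝ → ℝ → Finset ℕ)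
    (x : ℝ → ℝ → ℝ → ℕ → Fin 4 → ℝ)
    (h34 : ∃ C₀ T₀ : ℝ, ∀ T M N : ℝ, T₀ ≤ T → M ≤ Real.sqrt T → 1 < N → N < M →
      (bourgainR c M N T : ℝ) ≤ N → N ≤ (bourgainR c M N T : ℝ) ^ 2 →
        (bourgainR c M N T : ℝ) ≤ Q T M N ∧
        N * Q T M N / (bourgainR c M N T : ℝ) ^ 2 ≤ H T M N ∧
        (H T M N : ℝ) ≤ C₀ * N * Q T M N / (bourgainR c M N T : ℝ) ^ 2 ∧
        ((𝓘 T M N).card : ℝ) ≤ C₀ * M * (bourgainR c M N T : ℝ) ^ 2 / (N * (Q T M N : ℝ) ^ 2) ∧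
        ‖α T M N‖ ≤ 1 ∧
        (∀ I ∈ 𝓘 T M N, ∀ k, |x T M N I k| ≤
          bourgainXBound (((bourgainR c M N T : ℝ) / Q T M N) ^ 2 * Real.sqrt (H T M N)) k) ∧
        ‖bourgainSum Real.log T M‖ ≤ C₀ * (M * Real.log N / Real.sqrt N +
          (bourgainR c M N T : ℝ) * Real.log N ^ 2 / Real.sqrt (Q T M N) *
            ∑ I ∈ 𝓘 T M N, (‖bourgainHSum (H T M N) (α T M N) (x T M N I)‖ +
              (Q T M N : ℝ) / (bourgainR c M N T : ℝ))))
    (h311 : ∃ C₁ T₁ : ℝ, ∀ T M N : ℝ, T₁ ≤ T → M ≤ Real.sqrt T →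
      N = M * T ^ (-(2 / 7) : ℝ) → 1 < N → N < M →
      (bourgainR c M N T : ℝ) ≤ N → N ≤ (bourgainR c M N T : ℝ) ^ 2 →
      (Q T M N : ℝ) < (bourgainR c M N T : ℝ) ^ (2 / 3 : ℝ) * N ^ (1 / 3 : ℝ) →
        (bourgainSecondSpacingCount (𝓘 T M N) (x T M N) (H T M N) 1 : ℝ) ≤
          C₁ * (1 / (3 * (H T M N : ℝ) ^ 2)) *
            ((Q T M N : ℝ) ^ 2 / (6 * (bourgainR c M N T : ℝ) ^ 2 * (H T M N : ℝ) ^ 2)) *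
            (M / N) ^ 2 * ((Q T M N : ℝ) / (bourgainR c M N T : ℝ)) ^ 4)
    (h315 : ∃ C₂ T₂ : ℝ, ∀ T M N : ℝ, T₂ ≤ T → M ≤ Real.sqrt T → 1 < N → N < M →
      (bourgainR c M N T : ℝ) ≤ N → N ≤ (bourgainR c M N T : ℝ) ^ 2 →
      (Q T M N : ℝ) < (bourgainR c M N T : ℝ) ^ (2 / 3 : ℝ) * N ^ (1 / 3 : ℝ) →
      ∀ V : ℝ, (V = N / Q T M N ∧ N / Q T M N ≤ (bourgainR c M N T : ℝ) ^ 4 / N ^ 2) ∨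
          V = (bourgainR c M N T : ℝ) ^ 4 / N ^ 2 →
        V * (bourgainSecondSpacingCount (𝓘 T M N) (x T M N) (H T M N) V : ℝ) ≤
          C₂ * (V * M * (bourgainR c M N T : ℝ) ^ 2 / (N * (Q T M N : ℝ) ^ 2) +
            (1 / (3 * (H T M N : ℝ) ^ 2)) *
              ((Q T M N : ℝ) ^ 2 / (6 * (bourgainR c M N T : ℝ) ^ 2 * (H T M N : ℝ) ^ 2)) *
              ((Q T M N : ℝ) ^ 2 / (6 * (bourgainR c M N T : ℝ) ^ 2 * (H T M N : ℝ))) ^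
                (2 / 3 : ℝ) * (M / N) ^ 2) *
            ((Q T M N : ℝ) / (bourgainR c M N T : ℝ)) ^ 4)
    (hC3 : ∀ ε : ℝ, 0 < ε → ∃ C : ℝ, ∀ N : ℕ, 1 ≤ N → ∀ δ Δ : ℝ,
      1 / (N : ℝ) ^ 2 ≤ δ → δ ≤ 1 → 1 / (N : ℝ) ≤ Δ → Δ ≤ 1 →
        bourgainA6 N δ Δ ≤ C * δ * Δ * (N : ℝ) ^ (9 + ε)) :
    Bourgain2017_theorem4_log :=
  Bourgain2017_theorem4_log_of_eq312_of_eq316 hc hc1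
    (Bourgain2017_eq312_log_of_reduction c Q H α 𝓘 x h34 h311 hC3)
    (Bourgain2017_eq316_log_of_reduction c Q H α 𝓘 x h34 h315 hC3)

/-- **Bourgain 2017, (5.1) for `F = log`** (`Literature.NumberTheory.LFunctions.Bourgain2017_eq51_log`:
`|∑_{M/2 ≤ m ≤ M} e(T log(m/M))| ≪ M^{1/2}T^{13/84+ε}` for `1 ≤ M ≤ √T`) **from the reduction inputs
(3.4), (3.11), (3.15), Corollary 3, and the Robert–Sargos fourth-derivative test**
(`Literature.NumberTheory.LFunctions.Sargos2003_lemma4`, which covers `M ≤ T^{17/42}` exactly,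
`ZetaSubconvexityRobertSargos.lean`): Theorem 4 by `Bourgain2017_theorem4_log_of_reduction`, then
`Literature.NumberTheory.LFunctions.Bourgain2017_eq51_log_of_theorem4_of_sargos`.
[cite: BourgainJAMS2017, §5 eq. (5.1); Theorem 4] -/
theorem Bourgain2017_eq51_log_of_reduction_of_sargos {c : ℝ} (hc : 0 < c) (hc1 : c ≤ 1)
    (Q H : ℝ → ℝ → ℝ → ℕ) (α : ℝ → ℝ → ℝ → ℂ) (𝓘 : ℝ → ℝ → ℝ → Finset ℕ)
    (x : ℝ → ℝ → ℝ → ℕ → Fin 4 → ℝ)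
    (h34 : ∃ C₀ T₀ : ℝ, ∀ T M N : ℝ, T₀ ≤ T → M ≤ Real.sqrt T → 1 < N → N < M →
      (bourgainR c M N T : ℝ) ≤ N → N ≤ (bourgainR c M N T : ℝ) ^ 2 →
        (bourgainR c M N T : ℝ) ≤ Q T M N ∧
        N * Q T M N / (bourgainR c M N T : ℝ) ^ 2 ≤ H T M N ∧
        (H T M N : ℝ) ≤ C₀ * N * Q T M N / (bourgainR c M N T : ℝ) ^ 2 ∧
        ((𝓘 T M N).card : ℝ) ≤ C₀ * M * (bourgainR c M N T : ℝ) ^ 2 / (N * (Q T M N : ℝ) ^ 2) ∧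
        ‖α T M N‖ ≤ 1 ∧
        (∀ I ∈ 𝓘 T M N, ∀ k, |x T M N I k| ≤
          bourgainXBound (((bourgainR c M N T : ℝ) / Q T M N) ^ 2 * Real.sqrt (H T M N)) k) ∧
        ‖bourgainSum Real.log T M‖ ≤ C₀ * (M * Real.log N / Real.sqrt N +
          (bourgainR c M N T : ℝ) * Real.log N ^ 2 / Real.sqrt (Q T M N) *
            ∑ I ∈ 𝓘 T M N, (‖bourgainHSum (H T M N) (α T M N) (x T M N I)‖ +
              (Q T M N : ℝ) / (bourgainR c M N T : ℝ))))
    (h311 : ∃ C₁ T₁ : ℝ, ∀ T M N : ℝ, T₁ ≤ T → M ≤ Real.sqrt T →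
      N = M * T ^ (-(2 / 7) : ℝ) → 1 < N → N < M →
      (bourgainR c M N T : ℝ) ≤ N → N ≤ (bourgainR c M N T : ℝ) ^ 2 →
      (Q T M N : ℝ) < (bourgainR c M N T : ℝ) ^ (2 / 3 : ℝ) * N ^ (1 / 3 : ℝ) →
        (bourgainSecondSpacingCount (𝓘 T M N) (x T M N) (H T M N) 1 : ℝ) ≤
          C₁ * (1 / (3 * (H T M N : ℝ) ^ 2)) *
            ((Q T M N : ℝ) ^ 2 / (6 * (bourgainR c M N T : ℝ) ^ 2 * (H T M N : ℝ) ^ 2)) *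
            (M / N) ^ 2 * ((Q T M N : ℝ) / (bourgainR c M N T : ℝ)) ^ 4)
    (h315 : ∃ C₂ T₂ : ℝ, ∀ T M N : ℝ, T₂ ≤ T → M ≤ Real.sqrt T → 1 < N → N < M →
      (bourgainR c M N T : ℝ) ≤ N → N ≤ (bourgainR c M N T : ℝ) ^ 2 →
      (Q T M N : ℝ) < (bourgainR c M N T : ℝ) ^ (2 / 3 : ℝ) * N ^ (1 / 3 : ℝ) →
      ∀ V : ℝ, (V = N / Q T M N ∧ N / Q T M N ≤ (bourgainR c M N T : ℝ) ^ 4 / N ^ 2) ∨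
          V = (bourgainR c M N T : ℝ) ^ 4 / N ^ 2 →
        V * (bourgainSecondSpacingCount (𝓘 T M N) (x T M N) (H T M N) V : ℝ) ≤
          C₂ * (V * M * (bourgainR c M N T : ℝ) ^ 2 / (N * (Q T M N : ℝ) ^ 2) +
            (1 / (3 * (H T M N : ℝ) ^ 2)) *
              ((Q T M N : ℝ) ^ 2 / (6 * (bourgainR c M N T : ℝ) ^ 2 * (H T M N : ℝ) ^ 2)) *
              ((Q T M N : ℝ) ^ 2 / (6 * (bourgainR c M N T : ℝ) ^ 2 * (H T M N : ℝ))) ^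
                (2 / 3 : ℝ) * (M / N) ^ 2) *
            ((Q T M N : ℝ) / (bourgainR c M N T : ℝ)) ^ 4)
    (hC3 : ∀ ε : ℝ, 0 < ε → ∃ C : ℝ, ∀ N : ℕ, 1 ≤ N → ∀ δ Δ : ℝ,
      1 / (N : ℝ) ^ 2 ≤ δ → δ ≤ 1 → 1 / (N : ℝ) ≤ Δ → Δ ≤ 1 →
        bourgainA6 N δ Δ ≤ C * δ * Δ * (N : ℝ) ^ (9 + ε))
    (hRS : Sargos2003_lemma4) :
    Bourgain2017_eq51_log :=
  Bourgain2017_eq51_log_of_theorem4_of_sargos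
    (Bourgain2017_theorem4_log_of_reduction hc hc1 Q H α 𝓘 x h34 h311 h315 hC3) hRS

end Literature.NumberTheory.LFunctions
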